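import Literature.ComputerArithmetic.Shewchuk1997.ExpansionArithmetic
import Literature.ComputerArithmetic.BoldoJeannerodMelquiondMuller2023.TwoProd
import Literature.ComputerArithmetic.BoldoJeannerodMelquiondMuller2023.CorrectRoundingHalfUlp
import Literature.ComputerArithmetic.GraillatMuller2025.CRDWPlusFP
import Literature.ComputerArithmetic.JoldesMullerPopescu2017.DWTimesFP
import Literature.ComputerArithmetic.BoldoJeannerodMelquiondMuller2023.TwoProdDirected
import Mathlib.Tactic.Linarith
import Mathlib.Tactic.Positivity
import Mathlib.Tactic.Ring
import Mathlib.Tactic.NormNum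
import Mathlib.Tactic.LinearCombination

/-!
# Shewchuk (1997), §2.5–2.6: SPLIT, TWO-PRODUCT and SCALE-EXPANSION (Theorems 17–19, Lemmas 20–21)

J. R. Shewchuk, *Adaptive precision floating-point arithmetic and fast robust geometric
predicates*, Discrete Comput. Geom. 18 (1997) 305–363 [Shewchuk1997], §2.5 "Simple
multiplication" (Theorem 17 SPLIT, Theorem 18 TWO-PRODUCT, pp. 325–327) and §2.6 "Expansion
scaling" (Theorem 19 SCALE-EXPANSION with Lemmas 20 and 21, pp. 327–330).  Sequel of
`ExpansionArithmetic.lean` (§2.1–2.4: `Nonoverlapping`, `Below`, `IsExpansion`, FAST-TWO-SUM,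
TWO-SUM, GROW-EXPANSION, EXPANSION-SUM), whose model, dictionary and grid-invariant proof style are
kept.  As printed (p. 328):

> **Theorem 19.** Let `e = Σ_{i=1}^m eᵢ` be a nonoverlapping expansion of `m` `p`-bit components,
> and let `b` be a `p`-bit value where `p ≥ 4`. Suppose that the components of `e` are sorted in
> order of increasing magnitude, except that any of the `eᵢ` may be zero. Then the following
> algorithm will produce a nonoverlapping expansion `h` such that `h = Σ_{i=1}^{2m} hᵢ = be`, where
> the components of `h` are also in order of increasing magnitude, except that any of the `hᵢ`
> may be zero. Furthermore, if `e` is nonadjacent and round-to-even tiebreaking is used, then `h`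
> is nonadjacent.
> SCALE-EXPANSION(e, b): 1 `(Q₂, h₁) ⇐ TWO-PRODUCT(e₁, b)`; 2 for `i ⇐ 2` to `m`; 3 `(Tᵢ, tᵢ) ⇐
> TWO-PRODUCT(eᵢ, b)`; 4 `(Q₂ᵢ₋₁, h₂ᵢ₋₂) ⇐ TWO-SUM(Q₂ᵢ₋₂, tᵢ)`; 5 `(Q₂ᵢ, h₂ᵢ₋₁) ⇐
> FAST-TWO-SUM(Tᵢ, Q₂ᵢ₋₁)`; 6 `h₂ₘ ⇐ Q₂ₘ`; 7 return `h`.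
> **Lemma 20.** Let `eᵢ` and `eⱼ` be two nonoverlapping nonzero components of `e`, with `i < j`
> and `|eᵢ| < |eⱼ|`. Let `Tᵢ` be a correctly rounded approximation to `eᵢb`, and let
> `Tᵢ + tᵢ` be a two-component expansion exactly equal to `eᵢb` ... Then `tᵢ` does not overlap
> the double-width product `eⱼb`. Furthermore, if `eᵢ` and `eⱼ` are nonadjacent, then `tᵢ` is
> not adjacent to `eⱼb`.
> **Lemma 21.** For some `i`, let `r` be the smallest integer such that `|eᵢ| < 2^r` ... Then
> `|Q₂ᵢ| ≤ 2^r|b|`, and thus `|h₂ᵢ₋₁| ≤ 2^(r−1) ulp(b)`.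

MODEL / DICTIONARY (as in `ExpansionArithmetic.lean`).
* Floats are `JeannerodRump2018.IsFloat p emin` over `ℚ` (precision `p`, gradual underflow, no
  overflow); `fl` is ANY round-to-nearest map `IsRoundNearest p emin fl`; "round-to-even" is
  `roundTiesEven p emin`.  Expansions are `List ℚ` from the smallest component; "nonoverlapping
  [resp. nonadjacent] and increasing except for zeros" is `IsExpansion 1` [resp. `IsExpansion 2`]
  (= the paper's pairwise notions for float components: `isExpansion_one_iff` / `_two_iff`).  The
  two structural conclusions of Theorem 19 are ONE theorem in the parameter `c ∈ {1, 2}` with the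
  hypothesis `RoundoffBelow c fl` ("the roundoff of `fl` lies `c`-below the result": `c = 1` for
  every round-to-nearest, `roundoffBelow_one`; `c = 2` for round-to-even, Corollary 9,
  `roundoffBelow_two_roundTiesEven`).
* SCALE-EXPANSION is typed over an abstract TWO-PRODUCT `tp : ℚ → ℚ → ℚ × ℚ` with the hypothesis
  that it is exact on the operands met (`(tp eᵢ b).1 = eᵢ ⊗ b`, `.1 + .2 = eᵢb`), which is all the
  proof of Theorem 19 uses of Theorem 18; the hypothesis is discharged by the FMA two-product
  `twoProdFMA` [BoldoEtAl2023, Algorithm 3] for every `p ≥ 1` (`twoProdFMA_exact_of_rep`) and by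
  the paper's TWO-PRODUCT (Theorem 18, below).
* NO UNDERFLOW.  The paper's exponents range over all integers (p. 308).  §2.6 is proved here in
  the gradual-underflow format under the side conditions that make the paper's scaling arguments
  available: `b = M_b·2^(k_b)` with `|M_b| < 2^p` (any such representation, `k_b` free) and every
  component `eᵢ ∈ F_p ∩ 2^(emin − k_b)·ℤ-floats` (`IsFloat p emin eᵢ ∧ IsFloat p (emin − k_b) eᵢ`), so
  that the products `eᵢb`, their roundoffs `tᵢ` and the `2p`-bit grids of Lemmas 20–21 live above
  the quantum `2^emin`; both conditions are vacuous in the paper's model.  §2.5 inherits the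
  no-underflow hypothesis of [BoldoMelquiond2017] Lemma 5.23 (`ab = 0` or `a`, `b` normal with
  `|ab| ≥ 2^(emin+2p−1)`).
* PRECISION.  Given an exact two-product, Theorem 19 holds for every `p ≥ 1` (printed `p ≥ 4`, the
  range of TWO-PRODUCT); Theorem 17 is typed for `p ≥ 4`, `2 ≤ s ≤ p − 2` (printed `p ≥ 3`,
  `p/2 ≤ s ≤ p − 1`: the extreme split `s = p − 1` is NOT covered) and Theorem 18 for `p ≥ 4`,
  `p ≤ 2s ≤ p + 1`, i.e. `s = ⌈p/2⌉` (printed `p ≥ 6`), both for round-to-nearest maps that are ODD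
  (`fl(−t) = −fl(t)`: both IEEE 754 round-to-nearest attributes; Theorem 17's main clause for any
  tie rule) — through the dictionary SPLIT = Veltkamp (Algorithm 5.4 with the mirrored rounding at
  Line 2), TWO-PRODUCT(a, b) = Dekker's Algorithm 5.5 on `(b, a)` with `errᵢ = −tᵢ`
  [BoldoMelquiond2017, Theorems 5.18–5.19, Lemma 5.23].

ON THE PROOFS (recorded, not results).  Theorem 19 is proved as printed — the invariant
`Q₂ᵢ + Σ hⱼ = Σ eⱼb`, "each time a component of `h` is written, that component is smaller than and
does not overlap either the accumulator `Q` nor any of the remaining products" — with "hence [it]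
cannot overlap any portion of their sum" made explicit, as for Theorems 10 and 12, by a GRID
INVARIANT: the accumulator and all remaining products `eⱼb` (and therefore, rounding preserving
`2^g·ℤ` for `g ≥ emin`, everything computed from them) are multiples of a common `2^g > c·|hⱼ|`
(`exists_common_grid`, `onGrid_of_mem_scaleExpansionLoop`).  Lemma 20 is proved at format level
from `|tᵢ| ≤ ½ulp(eᵢb)` (`below_twoProduct_err_mul`).  In Lemma 21 the printed sentence "otherwise,
roundoff may occur, but the monotonicity of floating-point multiplication and addition ensures that
`|Q₂ᵢ|` cannot be larger than `2^r|b|`" is made precise as follows (`lemma21_step`): `Tᵢ + Q₂ᵢ₋₁ =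
eᵢb + Q₂ᵢ₋₂ − h₂ᵢ₋₂`, so `|Tᵢ + Q₂ᵢ₋₁| ≤ (2^r − 2^R)|b| + 2^R|b| + |h₂ᵢ₋₂|` where the Line-4
roundoff satisfies `|h₂ᵢ₋₂| < ½ulp(2^r b)` (Lemma 3), and a round-to-nearest cannot carry
`|x| < F + ½ulp(F)`, `F ∈ F`, beyond `F` (`abs_fl_le_of_abs_lt_add_half_ulp`); the consequence
`|h₂ᵢ₋₁| ≤ 2^(r−1)ulp(b)` is typed as `|h₂ᵢ₋₁| ≤ 2^(r+k_b−1)`.  The FAST-TWO-SUM precondition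
`|Tᵢ| ≥ |Q₂ᵢ₋₁|` of Line 5 is `abs_fl_add_le_abs_fst` (the paper's two cases `|eᵢ| = 2^R`,
`|eᵢ| ≥ 2^(R+1)`), and the remark "if an input component `eᵢ` is zero, then two zero output
components are produced, and the accumulator value is unchanged" is the branch `eᵢb = 0` of
`scaleExpansionLoop_spec` (it also covers `b = 0`).

PROVED HERE (0 named facts, 0 sorry): the algorithm `scaleExpansion` (with its loop
`scaleExpansionLoop`, lengths `2m`), **Lemma 20** (`below_twoProduct_err_mul`), **Lemma 21**
(`lemma21_step`, `abs_fl_add_le_abs_fst`), **Theorem 19** (`scaleExpansionLoop_spec`,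
`scaleExpansion_spec`; printed clauses `scaleExpansion_nonoverlapping` — any tie rule —,
`scaleExpansion_nonadjacent` — round-to-even —, `scaleExpansion_pairwise_nonoverlapping` in the
paper's pairwise wording; instances `scaleExpansion_twoProdFMA_nonoverlapping|nonadjacent`,
`scaleExpansion_twoProduct_nonoverlapping|nonadjacent`); SPLIT and **Theorem 17** (`split`,
`split_spec` for any tie rule, `split_below`: "nonoverlapping ... `|ahi| ≥ |alo|`" for odd `fl` and
normal `a`); TWO-PRODUCT and **Theorem 18** (`twoProduct`, `twoProduct_spec`,
`twoProduct_nonadjacent`).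

ERRATUM POINTER (added once the sequel files had landed; nothing below this file's theorems
changed): **Corollary 22** (p. 330: "if `e` is strongly nonoverlapping and round-to-even
tiebreaking is used, then `h` is strongly nonoverlapping") is FALSE AS PRINTED for every `p ≥ 3` and
every exact two-product.  The witnesses are NEW WORK, proved in
`Summits/Ventures/CertifiedArithmetic/Expansions/ScaleExpansionWitness.lean` and
`Summits/Ventures/CertifiedArithmetic/Expansions/ScaleExpansionCounterexample.lean`
(`printedCorollary22_conclusion_false`; smallest instance `p = 4`: `e = ⟨5, 16, −32⟩`, `b = 13`,
`h = SCALE-EXPANSION(e, b) = ⟨1, 0, 16, 0, 0, −160⟩`, in which `16 = 2^4` and `−160 = −5·2^5` are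
adjacent and `160` is not a power of two), so Corollary 22 must NOT be entered in this directory as a
named fact; what is true of it — `h` is nonoverlapping, and nonadjacent under round-to-even — is
Theorem 19, typed above.  Theorem 13 (FAST-EXPANSION-SUM, whose printed "strongly nonoverlapping"
conclusion is likewise false, with the correct weaker statement proved) is `FastExpansionSum.lean`;
Theorem 23 (COMPRESS, true as printed) is `Compress.lean`.

NOT TYPED: §2.8, §§3–4; Theorem 17 with `s = p − 1` or `p = 3`; Theorem 18 for a round-to-nearest
that is not odd, or with subnormal / underflowing operands; the "zero elimination" variants.
-/

namespace Literature.ComputerArithmetic.Shewchuk1997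

open Literature.ComputerArithmetic.JeannerodRump2018
open Literature.ComputerArithmetic.BoldoJeannerodMelquiondMuller2023 hiding twoSum
open Literature.ComputerArithmetic.BoldoMelquiond2017 (veltkampSplit veltkampSplit_eq theorem_5_18_5_19
  veltkamp_RN_binade dekkerProduct dekkerProduct_fst dekkerProduct_snd lemma_5_23)
open Literature.ComputerArithmetic.GraillatMuller2025 (roundTiesEven_neg)
open Literature.ComputerArithmetic.JoldesMullerPopescu2017 (abs_fl_le_of_abs_le)

variable {p : ℕ} {emin : ℤ} {fl : ℚ → ℚ}

/-! ### Rounding facts used by the proofs of Lemmas 20–21 -/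

/-- A `p`-bit float is a `2p`-bit float (used to put products `eᵢ·b ∈ F_2p` and accumulators
`Qᵢ ∈ F_p` on one grid). [cite: Shewchuk1997, §2.1 p. 308 (model)] -/
theorem isFloat_widen {x : ℚ} (h : IsFloat p emin x) : IsFloat (p + p) emin x := by
  obtain ⟨M, e, hM, he, rfl⟩ := h
  exact ⟨M, e, lt_of_lt_of_le hM (pow_le_pow_right₀ (by norm_num) (Nat.le_add_right p p)), he, rfl⟩

/-- A multiple of `2^emin` of magnitude `< 2^(emin+p)` is a float (gradual underflow: "each eᵢb
... expressible in p bits" in the subnormal range). [cite: Shewchuk1997, §2.1 p. 308 (model)] -/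
theorem isFloat_of_onGrid_of_abs_lt {x : ℚ} (hx : OnGrid emin x)
    (h : |x| < (2 : ℚ) ^ (emin + p)) : IsFloat p emin x := by
  obtain ⟨N, rfl⟩ := hx
  have h2 : (0 : ℚ) < (2 : ℚ) ^ emin := zpow_pos (by norm_num) _
  rw [abs_mul, abs_of_pos h2, zpow_add₀ (by norm_num : (2 : ℚ) ≠ 0), zpow_natCast, mul_comm] at h
  have hN : |(N : ℚ)| < 2 ^ p := lt_of_mul_lt_mul_left h h2.le
  have hN' : |N| < 2 ^ p := by rw [← Int.cast_abs] at hN; exact_mod_cast hN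
  exact isFloat_of_int_mul N emin hN' le_rfl

/-- **ROUNDING CANNOT JUMP PAST A FLOAT BY LESS THAN HALF ITS ULP**: for `F ∈ F`, `F ≥ 0` and
`|t| < F + ½ulp(F)`, `|fl t| ≤ F` (if `|t| ≤ F` by monotonicity; otherwise `F` is the float nearest
`|t|`, since `ulp(t) ≥ ulp(F)`). This is the step the printed proof of Lemma 21 compresses into
"the monotonicity of floating-point operations ensures that `|Q₂ᵢ|` cannot be larger than `2^r|b|`".
[cite: Shewchuk1997, Lemma 21 p. 329 (proof)] -/
theorem abs_fl_le_of_abs_lt_add_half_ulp (hp : 1 ≤ p) (hfl : IsRoundNearest p emin fl) {F t : ℚ}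
    (hF : IsFloat p emin F) (hF0 : 0 ≤ F) (h : |t| < F + ulp p emin F / 2) : |fl t| ≤ F := by
  rcases le_or_gt |t| F with hle | hlt
  · exact abs_fl_le_of_abs_le hfl hF hle
  · have hu : ulp p emin F ≤ ulp p emin t := ulp_mono (by rw [abs_of_nonneg hF0]; exact hlt.le)
    rcases le_or_gt 0 t with ht0 | ht0
    · rw [abs_of_nonneg ht0] at hlt h
      have h1 : |t - F| < ulp p emin t / 2 := by
        rw [abs_of_nonneg (by linarith)]; linarith
      rw [fl_eq_of_abs_sub_lt_half_ulp hp hfl hF h1, abs_of_nonneg hF0]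
    · rw [abs_of_neg ht0] at hlt h
      have h1 : |t - (-F)| < ulp p emin t / 2 := by
        rw [abs_of_nonpos (by linarith)]; linarith
      rw [fl_eq_of_abs_sub_lt_half_ulp hp hfl hF.neg h1, abs_neg, abs_of_nonneg hF0]


/-- For `ulp(t) = 2^u` with `u > emin` the number is normal: `2^(u+p−1) ≤ |t|`.
[cite: Shewchuk1997, §2.1 p. 308 (model)] -/
theorem two_zpow_le_abs_of_ulp_eq {t : ℚ} {u : ℤ} (hu : ulp p emin t = (2 : ℚ) ^ u)
    (hue : emin < u) : (2 : ℚ) ^ (u + p - 1) ≤ |t| := by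
  have hinj : Function.Injective (fun n : ℤ => (2 : ℚ) ^ n) :=
    zpow_right_injective₀ (by norm_num) (by norm_num)
  have ht0 : t ≠ 0 := by
    rintro rfl
    rw [ulp_zero] at hu
    have := hinj hu
    omega
  rw [ulp_of_ne_zero ht0] at hu
  have hmax : max emin (Int.log 2 |t| - p + 1) = u := by
    have := hinj hu; simpa using this
  have hlog : Int.log 2 |t| = u + p - 1 := by
    rcases max_choice emin (Int.log 2 |t| - p + 1) with h | h <;> rw [h] at hmax <;> omega
  rw [← hlog]; exact zpow_log_le_abs ht0

/-! ### §2.6 SCALE-EXPANSION: the algorithm -/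

/-- **SCALE-EXPANSION, Lines 2–6** on the remaining components `[eᵢ, …, e_m]`, from the accumulator
`Q = Q₂ᵢ₋₂`: `(Tᵢ, tᵢ) ⇐ TWO-PRODUCT(eᵢ, b)`; `(Q₂ᵢ₋₁, h₂ᵢ₋₂) ⇐ TWO-SUM(Q₂ᵢ₋₂, tᵢ)`;
`(Q₂ᵢ, h₂ᵢ₋₁) ⇐ FAST-TWO-SUM(Tᵢ, Q₂ᵢ₋₁)`; …; `h₂ₘ ⇐ Q₂ₘ`; returns `[h₂ᵢ₋₂, h₂ᵢ₋₁, …, h₂ₘ]`.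
The two-product is a PARAMETER `tp` — any map returning `(eᵢ ⊗ b, eᵢb − eᵢ ⊗ b)` on the operands at
hand (Dekker's TWO-PRODUCT of §2.5 in the paper; an FMA-based one, `twoProdFMA`, below).
[cite: Shewchuk1997, Thm 19 p. 328 (Fig. 13)] -/
def scaleExpansionLoop (tp : ℚ → ℚ → ℚ × ℚ) (fl : ℚ → ℚ) (b : ℚ) : List ℚ → ℚ → List ℚ
  | [], Q => [Q]
  | e :: es, Q =>
      (twoSum fl Q (tp e b).2).2 ::
        (fastTwoSum fl (tp e b).1 (twoSum fl Q (tp e b).2).1).2 ::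
          scaleExpansionLoop tp fl b es (fastTwoSum fl (tp e b).1 (twoSum fl Q (tp e b).2).1).1

/-- **SCALE-EXPANSION(e, b)**: `(Q₂, h₁) ⇐ TWO-PRODUCT(e₁, b)`; `for i ⇐ 2 to m: (Tᵢ, tᵢ) ⇐
TWO-PRODUCT(eᵢ, b); (Q₂ᵢ₋₁, h₂ᵢ₋₂) ⇐ TWO-SUM(Q₂ᵢ₋₂, tᵢ); (Q₂ᵢ, h₂ᵢ₋₁) ⇐ FAST-TWO-SUM(Tᵢ, Q₂ᵢ₋₁)`;
`h₂ₘ ⇐ Q₂ₘ`; `return h` — on `e = [e₁, …, e_m]` (smallest first) it returns `[h₁, …, h₂ₘ]`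
(and `[]` on the empty expansion). [cite: Shewchuk1997, Thm 19 p. 328 (Fig. 13)] -/
def scaleExpansion (tp : ℚ → ℚ → ℚ × ℚ) (fl : ℚ → ℚ) : List ℚ → ℚ → List ℚ
  | [], _ => []
  | e :: es, b => (tp e b).2 :: scaleExpansionLoop tp fl b es (tp e b).1

/-- The loop on no remaining components: `h₂ₘ ⇐ Q₂ₘ`. [cite: Shewchuk1997, Thm 19 p. 328 (Line 6)] -/
theorem scaleExpansionLoop_nil (tp : ℚ → ℚ → ℚ × ℚ) (fl : ℚ → ℚ) (b Q : ℚ) :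
    scaleExpansionLoop tp fl b [] Q = [Q] := rfl

/-- One iteration of Lines 3–5. [cite: Shewchuk1997, Thm 19 p. 328 (Lines 3–5)] -/
theorem scaleExpansionLoop_cons (tp : ℚ → ℚ → ℚ × ℚ) (fl : ℚ → ℚ) (b e : ℚ) (es : List ℚ) (Q : ℚ) :
    scaleExpansionLoop tp fl b (e :: es) Q =
      (twoSum fl Q (tp e b).2).2 ::
        (fastTwoSum fl (tp e b).1 (twoSum fl Q (tp e b).2).1).2 ::
          scaleExpansionLoop tp fl b es (fastTwoSum fl (tp e b).1 (twoSum fl Q (tp e b).2).1).1 :=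
  rfl

/-- SCALE-EXPANSION of the empty expansion is empty. [cite: Shewchuk1997, Thm 19 p. 328] -/
theorem scaleExpansion_nil (tp : ℚ → ℚ → ℚ × ℚ) (fl : ℚ → ℚ) (b : ℚ) :
    scaleExpansion tp fl [] b = [] := rfl

/-- Line 1 then the loop. [cite: Shewchuk1997, Thm 19 p. 328 (Line 1)] -/
theorem scaleExpansion_cons (tp : ℚ → ℚ → ℚ × ℚ) (fl : ℚ → ℚ) (e : ℚ) (es : List ℚ) (b : ℚ) :
    scaleExpansion tp fl (e :: es) b = (tp e b).2 :: scaleExpansionLoop tp fl b es (tp e b).1 := rfl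

/-- The loop emits `2(m − i + 1) + 1` components. [cite: Shewchuk1997, Thm 19 p. 328] -/
theorem length_scaleExpansionLoop (tp : ℚ → ℚ → ℚ × ℚ) (fl : ℚ → ℚ) (b : ℚ) (es : List ℚ) (Q : ℚ) :
    (scaleExpansionLoop tp fl b es Q).length = 2 * es.length + 1 := by
  induction es generalizing Q with
  | nil => rfl
  | cons e es ih => simp only [scaleExpansionLoop_cons, List.length_cons, ih]; ring

/-- "h = Σ_{i=1}^{2m} hᵢ": SCALE-EXPANSION of `m` components has `2m` components.
[cite: Shewchuk1997, Thm 19 p. 328] -/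
theorem length_scaleExpansion (tp : ℚ → ℚ → ℚ × ℚ) (fl : ℚ → ℚ) (e : List ℚ) (b : ℚ) :
    (scaleExpansion tp fl e b).length = 2 * e.length := by
  cases e with
  | nil => rfl
  | cons x xs => simp only [scaleExpansion_cons, List.length_cons, length_scaleExpansionLoop]; ring

/-- TWO-SUM keeps the grid `2^g·ℤ`, `g ≥ emin` (every line is a rounded sum/difference of grid
points). [cite: Shewchuk1997, Thm 19 p. 329 (proof, "cannot overlap any portion of their sum")] -/
theorem onGrid_twoSum (hp : 1 ≤ p) (hfl : IsRoundNearest p emin fl) {g : ℤ} (hg : emin ≤ g)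
    {a b : ℚ} (ha : OnGrid g a) (hb : OnGrid g b) :
    OnGrid g (twoSum fl a b).1 ∧ OnGrid g (twoSum fl a b).2 := by
  have hx : OnGrid g (fl (a + b)) := (ha.add hb).fl_of hp hfl hg
  have hbv : OnGrid g (fl (fl (a + b) - a)) := (hx.sub ha).fl_of hp hfl hg
  have hav : OnGrid g (fl (fl (a + b) - fl (fl (a + b) - a))) := (hx.sub hbv).fl_of hp hfl hg
  have hbr : OnGrid g (fl (b - fl (fl (a + b) - a))) := (hb.sub hbv).fl_of hp hfl hg
  have har : OnGrid g (fl (a - fl (fl (a + b) - fl (fl (a + b) - a)))) :=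
    (ha.sub hav).fl_of hp hfl hg
  exact ⟨hx, (har.add hbr).fl_of hp hfl hg⟩

/-- FAST-TWO-SUM keeps the grid `2^g·ℤ`, `g ≥ emin`.
[cite: Shewchuk1997, Thm 19 p. 329 (proof, "cannot overlap any portion of their sum")] -/
theorem onGrid_fastTwoSum (hp : 1 ≤ p) (hfl : IsRoundNearest p emin fl) {g : ℤ} (hg : emin ≤ g)
    {a b : ℚ} (ha : OnGrid g a) (hb : OnGrid g b) :
    OnGrid g (fastTwoSum fl a b).1 ∧ OnGrid g (fastTwoSum fl a b).2 := by
  have hx : OnGrid g (fl (a + b)) := (ha.add hb).fl_of hp hfl hg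
  exact ⟨hx, (hb.sub ((hx.sub ha).fl_of hp hfl hg)).fl_of hp hfl hg⟩

/-- **"hence, the component cannot overlap any portion of their sum"**: if the accumulator and both
parts of every remaining product lie on a grid `2^g·ℤ` (`g ≥ emin`), so does every later output of
the loop. [cite: Shewchuk1997, Thm 19 p. 329 (proof)] -/
theorem onGrid_of_mem_scaleExpansionLoop (hp : 1 ≤ p) (hfl : IsRoundNearest p emin fl) {g : ℤ}
    (hg : emin ≤ g) {tp : ℚ → ℚ → ℚ × ℚ} {b : ℚ} {es : List ℚ} {Q : ℚ} (hQ : OnGrid g Q)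
    (htp : ∀ x ∈ es, OnGrid g (tp x b).1 ∧ OnGrid g (tp x b).2) :
    ∀ z ∈ scaleExpansionLoop tp fl b es Q, OnGrid g z := by
  induction es generalizing Q with
  | nil => simpa [scaleExpansionLoop_nil] using hQ
  | cons x xs ih =>
    obtain ⟨⟨hT, ht⟩, htps⟩ := List.forall_mem_cons.mp htp
    have h1 := onGrid_twoSum hp hfl hg hQ ht
    have h2 := onGrid_fastTwoSum hp hfl hg hT h1.1
    intro z hz
    rw [scaleExpansionLoop_cons] at hz
    rcases List.mem_cons.mp hz with rfl | hz
    · exact h1.2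
    rcases List.mem_cons.mp hz with rfl | hz
    · exact h2.2
    · exact ih h2.1 htps z hz

/-- The loop emits floats (from a float accumulator). [cite: Shewchuk1997, Thm 19 p. 328] -/
theorem isFloat_of_mem_scaleExpansionLoop (hfl : IsRoundNearest p emin fl) {tp : ℚ → ℚ → ℚ × ℚ}
    {b : ℚ} {es : List ℚ} {Q : ℚ} (hQ : IsFloat p emin Q) :
    ∀ z ∈ scaleExpansionLoop tp fl b es Q, IsFloat p emin z := by
  induction es generalizing Q with
  | nil => simpa [scaleExpansionLoop_nil] using hQ
  | cons x xs ih =>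
    intro z hz
    rw [scaleExpansionLoop_cons] at hz
    rcases List.mem_cons.mp hz with rfl | hz
    · exact (isFloat_twoSum hfl _ _).2
    rcases List.mem_cons.mp hz with rfl | hz
    · exact (isFloat_fastTwoSum hfl _ _).2
    · exact ih (isFloat_fastTwoSum hfl _ _).1 z hz

/-- FAST-TWO-SUM(0, Q) = (Q, 0) for a float `Q` ("if Tᵢ = 0 ... FAST-TWO-SUM still works correctly";
zero components are a pipeline delay). [cite: Shewchuk1997, Thm 19 p. 330 (proof)] -/
theorem fastTwoSum_zero_left (hfl : IsRoundNearest p emin fl) {Q : ℚ} (hQ : IsFloat p emin Q) :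
    fastTwoSum fl 0 Q = (Q, 0) := by
  have hQ' : fl Q = Q := fl_eq_self hfl hQ
  show (fl (0 + Q), fl (Q - fl (fl (0 + Q) - 0))) = (Q, 0)
  rw [zero_add, hQ', sub_zero, hQ', sub_self, fl_zero hfl]

/-! ### §2.6 Lemma 20: the low part of `eᵢ ⊗ b` against the later products

MODEL OF "NO UNDERFLOW IN THE PRODUCTS". The paper works with exponent-unbounded `p`-bit numbers;
in the tree's gradual-underflow format the two-product `Tᵢ + tᵢ = eᵢb` is exact only when `eᵢb` does
not underflow [BoldoEtAl2023, Property 2.12]. We fix ONE representation `b = M_b·2^kb` (`|M_b| < 2^p`)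
of the multiplier and ask each component to be a `p`-bit multiple `M·2^k` of a quantum with
`k + kb ≥ emin` (`IsFloat p (emin − kb) eᵢ`): then every `eᵢb = (M M_b)·2^(k+kb)` is a `2p`-bit number
of the format and every `2^s·b`, `s ≥ k`, is a float — exactly the exponent-unbounded facts the
printed proofs use ("2^r|b| is expressible in p bits", "e_j b is an integer"). -/

/-- A component times the multiplier is a `2p`-bit number of the format ("the double-width product
`e_j b`"). [cite: Shewchuk1997, Lemma 20 p. 328–329] -/
theorem isFloat_two_mul_prod {b : ℚ} {Mb kb : ℤ} (hbrep : b = (Mb : ℚ) * 2 ^ kb) (hMb : |Mb| < 2 ^ p)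
    {y : ℚ} (hyU : IsFloat p (emin - kb) y) : IsFloat (p + p) emin (y * b) := by
  obtain ⟨M, k, hM, hk, rfl⟩ := hyU
  refine ⟨M * Mb, k + kb, ?_, by omega, ?_⟩
  · rw [abs_mul, pow_add]
    exact mul_lt_mul'' hM hMb (abs_nonneg _) (abs_nonneg _)
  · rw [hbrep, zpow_add₀ (by norm_num : (2 : ℚ) ≠ 0)]; push_cast; ring

/-- `2^s·|b|` is a float once `s + kb ≥ emin` ("2^r|b| is expressible in p bits").
[cite: Shewchuk1997, Lemma 21 p. 329 (proof)] -/
theorem isFloat_two_zpow_mul_abs {b : ℚ} {Mb kb : ℤ} (hbrep : b = (Mb : ℚ) * 2 ^ kb)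
    (hMb : |Mb| < 2 ^ p) {s : ℤ} (hs : emin ≤ s + kb) : IsFloat p emin ((2 : ℚ) ^ s * |b|) := by
  have h : (2 : ℚ) ^ s * |b| = ((|Mb| : ℤ) : ℚ) * (2 : ℚ) ^ (s + kb) := by
    rw [hbrep, abs_mul, abs_of_pos (zpow_pos (by norm_num : (0:ℚ) < 2) _), Int.cast_abs,
      zpow_add₀ (by norm_num : (2 : ℚ) ≠ 0)]; ring
  rw [h]; exact isFloat_of_int_mul _ _ (by rwa [abs_abs]) hs

/-- `|b| < 2^(p + kb)` for the fixed representation. [cite: Shewchuk1997, Lemma 20 p. 329 (proof)] -/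
theorem abs_lt_of_rep {b : ℚ} {Mb kb : ℤ} (hbrep : b = (Mb : ℚ) * 2 ^ kb) (hMb : |Mb| < 2 ^ p) :
    |b| < (2 : ℚ) ^ (p : ℤ) * (2 : ℚ) ^ kb := by
  have hMbq : |(Mb : ℚ)| < 2 ^ p := by rw [← Int.cast_abs]; exact_mod_cast hMb
  rw [hbrep, abs_mul, abs_of_pos (zpow_pos (by norm_num : (0:ℚ) < 2) _), zpow_natCast]
  exact mul_lt_mul_of_pos_right hMbq (zpow_pos (by norm_num) _)

/-- Exponent bookkeeping behind "scale e so that … |eᵢ| < 1" (nonoverlapping, `c = 1`: `r = s`) and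
"… |eᵢ| < ½" (nonadjacent, `c = 2`: `r = s − 1`, still `≥ emin − kb` because the nonzero `p`-bit
component `eᵢ` has its quantum below `2^(s−1)`). [cite: Shewchuk1997, Lemma 20 p. 329 (proof)] -/
theorem exists_exp_of_gap {c x : ℚ} (hc : c = 1 ∨ c = 2) {kb s : ℤ}
    (hxU : IsFloat p (emin - kb) x) (hx0 : x ≠ 0) (hs : emin - kb ≤ s)
    (hcx : c * |x| < (2 : ℚ) ^ s) :
    ∃ r : ℤ, |x| < (2 : ℚ) ^ r ∧ emin ≤ r + kb ∧
      c * (2 : ℚ) ^ (r + kb - 1) < (2 : ℚ) ^ (s + kb) := by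
  have h2 : (2 : ℚ) ≠ 0 := by norm_num
  rcases hc with rfl | rfl
  · refine ⟨s, by simpa using hcx, by omega, ?_⟩
    rw [one_mul]; exact zpow_lt_zpow_right₀ (by norm_num) (by omega)
  · obtain ⟨M, k, hM, hk, rfl⟩ := hxU
    have hM0 : M ≠ 0 := by rintro rfl; simp at hx0
    have h1 : (1 : ℚ) ≤ |(M : ℚ)| := by rw [← Int.cast_abs]; exact_mod_cast Int.one_le_abs hM0
    have h2k : (0 : ℚ) < (2 : ℚ) ^ k := zpow_pos (by norm_num) _
    have hlo : (2 : ℚ) ^ k ≤ |(M : ℚ) * 2 ^ k| := by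
      rw [abs_mul, abs_of_pos h2k]; exact le_mul_of_one_le_left h2k.le h1
    have hs2 : (2 : ℚ) ^ s = 2 ^ (s - 1) * 2 := by rw [← zpow_add_one₀ h2, sub_add_cancel]
    have hhi : |(M : ℚ) * 2 ^ k| < (2 : ℚ) ^ (s - 1) := by rw [hs2] at hcx; linarith
    have hks : k < s - 1 :=
      (zpow_lt_zpow_iff_right₀ (by norm_num : (1 : ℚ) < 2)).mp (hlo.trans_lt hhi)
    refine ⟨s - 1, hhi, by omega, ?_⟩
    have : (2 : ℚ) * 2 ^ (s - 1 + kb - 1) = 2 ^ (s + kb - 1) := by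
      rw [mul_comm, ← zpow_add_one₀ h2]; congr 1; ring
    rw [this]; exact zpow_lt_zpow_right₀ (by norm_num) (by omega)

/-- **LEMMA 20.** "Let `eᵢ` and `e_j` be two nonoverlapping [resp. nonadjacent] components of `e`
with `i < j` and `|eᵢ| < |e_j|`. Let `Tᵢ` be a correctly rounded approximation to `eᵢb`, and let
`Tᵢ + tᵢ` be a two-component expansion exactly equal to `eᵢb`. Then `tᵢ` is too small in magnitude to
overlap the double-width product `e_j b` [resp. `tᵢ` is not adjacent to `e_j b`]." Oriented form:
`tᵢ` lies `c`-below `e_j b` (`c = 1`: nonoverlapping, `c = 2`: nonadjacent), any tie rule, in the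
no-underflow model above. [cite: Shewchuk1997, Lemma 20 p. 328–329] -/
theorem below_twoProduct_err_mul (hp : 1 ≤ p) (hfl : IsRoundNearest p emin fl) {c : ℚ}
    (hc : c = 1 ∨ c = 2) {b : ℚ} {Mb kb : ℤ} (hbrep : b = (Mb : ℚ) * 2 ^ kb) (hMb : |Mb| < 2 ^ p)
    {x y T t : ℚ} (hxU : IsFloat p (emin - kb) x) (hyU : IsFloat p (emin - kb) y)
    (hxy : Below c x y) (hT : T = fl (x * b)) (hTt : T + t = x * b) :
    Below c t (y * b) := by
  have h2 : (2 : ℚ) ≠ 0 := by norm_num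
  have h20 : (0 : ℚ) < 2 := by norm_num
  have hc0 : (0 : ℚ) ≤ c := by rcases hc with rfl | rfl <;> norm_num
  obtain ⟨s, hs, ⟨ρ, hy⟩, hcx⟩ := hxy.normalize hyU
  refine ⟨s + kb, ⟨ρ * Mb, by rw [hy, hbrep, zpow_add₀ h2]; push_cast; ring⟩, ?_⟩
  have ht : t = x * b - fl (x * b) := by linarith
  by_cases hxb : x * b = 0
  · rw [ht, hxb, fl_zero hfl, sub_zero, abs_zero, mul_zero]; exact zpow_pos h20 _
  have hx0 : x ≠ 0 := fun h => hxb (by rw [h, zero_mul])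
  obtain ⟨r, hxr, hr, hcr⟩ := exists_exp_of_gap hc hxU hx0 hs hcx
  have hxb_lt : |x * b| < (2 : ℚ) ^ ((p : ℤ) + (r + kb)) := by
    rw [abs_mul, zpow_add₀ h2, zpow_add₀ h2]
    calc |x| * |b| ≤ (2 : ℚ) ^ r * |b| := mul_le_mul_of_nonneg_right hxr.le (abs_nonneg b)
      _ < (2 : ℚ) ^ r * ((2 : ℚ) ^ (p : ℤ) * 2 ^ kb) :=
          mul_lt_mul_of_pos_left (abs_lt_of_rep hbrep hMb) (zpow_pos h20 _)
      _ = _ := by ring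
  have hulp : ulp p emin (x * b) ≤ (2 : ℚ) ^ (r + kb) := ulp_le_two_zpow_of_abs_lt hr hxb_lt
  have herr : |t| ≤ (2 : ℚ) ^ (r + kb) / 2 := by
    rw [ht]; exact (abs_sub_fl_le_half_ulp hp hfl _).trans (by linarith)
  have hhalf : (2 : ℚ) ^ (r + kb) / 2 = 2 ^ (r + kb - 1) := by rw [zpow_sub_one₀ h2]; ring
  calc c * |t| ≤ c * (2 : ℚ) ^ (r + kb - 1) := by
        rw [← hhalf]; exact mul_le_mul_of_nonneg_left herr hc0
    _ < (2 : ℚ) ^ (s + kb) := hcr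


/-! ### §2.6 Lemma 21 and the FAST-TWO-SUM precondition of Line 5 -/

/-- **"The use of FAST-TWO-SUM in Line 5 is justified because |Tᵢ| ≥ |Q₂ᵢ₋₁|"**: with `eᵢ` a nonzero
multiple of `2^R`, `|Q₂ᵢ₋₂| ≤ 2^R|b|` and `2^R b` a float — "if `|eᵢ| = 2^R`, then `Tᵢ` is computed
exactly and `tᵢ = 0`, so `|Tᵢ| = 2^R|b| ≥ |Q₂ᵢ₋₂| = |Q₂ᵢ₋₁|. If `|eᵢ|` is larger than `2^R`, it is at
least twice as large, and hence `Tᵢ` is at least `2|Q₂ᵢ₋₂|`, so even if roundoff occurs and `tᵢ` is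
not zero, `|Tᵢ| > |Q₂ᵢ₋₂| + |tᵢ| ≥ |Q₂ᵢ₋₁|`" (we use `|tᵢ| ≤ ½ulp(Tᵢ) ≤ ½|Tᵢ|`). Any tie rule, `p ≥ 1`.
[cite: Shewchuk1997, Thm 19 p. 330 (proof)] -/
theorem abs_fl_add_le_abs_fst (hp : 1 ≤ p) (hfl : IsRoundNearest p emin fl) {b : ℚ} {Mb kb : ℤ}
    (hbrep : b = (Mb : ℚ) * 2 ^ kb) (hMb : |Mb| < 2 ^ p) {x Q T t : ℚ} {R : ℤ}
    (hQ : IsFloat p emin Q) (hR : emin ≤ R + kb) (hxR : OnGrid R x) (hQR : |Q| ≤ (2 : ℚ) ^ R * |b|)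
    (hxb : x * b ≠ 0) (hT : T = fl (x * b)) (hTt : T + t = x * b) : |fl (Q + t)| ≤ |T| := by
  have h2 : (2 : ℚ) ≠ 0 := by norm_num
  have h20 : (0 : ℚ) < 2 := by norm_num
  have ht : t = x * b - fl (x * b) := by linarith
  have hTF : IsFloat p emin T := by rw [hT]; exact (hfl _).1
  have hx0 : x ≠ 0 := fun h => hxb (by rw [h, zero_mul])
  obtain ⟨ρ, hx⟩ := hxR
  have hρ0 : ρ ≠ 0 := by rintro rfl; simp [hx] at hx0
  have h2R : (0 : ℚ) < (2 : ℚ) ^ R := zpow_pos h20 _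
  have hxabs : |x| = |(ρ : ℚ)| * 2 ^ R := by rw [hx, abs_mul, abs_of_pos h2R]
  rcases eq_or_lt_of_le (Int.one_le_abs hρ0) with hρ1 | hρ2
  · -- |eᵢ| = 2^R: the product is the float ρ·M_b·2^(R+kb), tᵢ = 0
    have hprodF : IsFloat p emin (x * b) := by
      have hρMb : |ρ * Mb| < 2 ^ p := by rw [abs_mul, ← hρ1, one_mul]; exact hMb
      have : x * b = ((ρ * Mb : ℤ) : ℚ) * (2 : ℚ) ^ (R + kb) := by
        rw [hx, hbrep, zpow_add₀ h2]; push_cast; ring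
      rw [this]; exact isFloat_of_int_mul _ _ hρMb hR
    have ht0 : t = 0 := by rw [ht, fl_eq_self hfl hprodF, sub_self]
    have hρq : |(ρ : ℚ)| = 1 := by rw [← Int.cast_abs, ← hρ1]; simp
    rw [ht0, add_zero, fl_eq_self hfl hQ, hT, fl_eq_self hfl hprodF, abs_mul, hxabs, hρq, one_mul]
    exact hQR
  · -- |eᵢ| ≥ 2^(R+1): Tᵢ ≥ 2^(R+1)|b| ≥ 2|Q|, and |tᵢ| ≤ ½ulp(Tᵢ) ≤ ½|Tᵢ|
    have hρ2q : (2 : ℚ) ≤ |(ρ : ℚ)| := by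
      rw [← Int.cast_abs]; exact_mod_cast (show (2 : ℤ) ≤ |ρ| by omega)
    have hGF : IsFloat p emin ((2 : ℚ) ^ (R + 1) * |b|) :=
      isFloat_two_zpow_mul_abs hbrep hMb (by omega)
    have hG0 : (0 : ℚ) ≤ (2 : ℚ) ^ (R + 1) * |b| := mul_nonneg (zpow_pos h20 _).le (abs_nonneg b)
    have hGle : (2 : ℚ) ^ (R + 1) * |b| ≤ |x * b| := by
      rw [abs_mul, hxabs, zpow_add_one₀ h2]
      exact mul_le_mul_of_nonneg_right (by nlinarith [h2R]) (abs_nonneg b)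
    have hGT : (2 : ℚ) ^ (R + 1) * |b| ≤ |T| := by
      have := abs_le_abs_fl hfl hGF (t := x * b) (by rwa [abs_of_nonneg hG0])
      rwa [abs_of_nonneg hG0, ← hT] at this
    have hQT : |Q| ≤ |T| / 2 := by
      rw [zpow_add_one₀ h2] at hGT; nlinarith [hQR, hGT, abs_nonneg b, h2R]
    -- |t| ≤ ulp(T)/2 ≤ |T|/2
    have hb0 : b ≠ 0 := fun h => hxb (by rw [h, mul_zero])
    have hbpos : (0 : ℚ) < |b| := abs_pos.mpr hb0
    have hulpT : ulp p emin T ≤ |T| := by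
      rcases le_or_gt ((2 : ℚ) ^ (emin + p - 1)) |T| with hn | hsub
      · have h1 := ulp_le_of_normal (emin := emin) hp hn
        have h2p : (1 : ℚ) ≤ 2 ^ (p - 1) := one_le_pow₀ (by norm_num)
        exact h1.trans (div_le_self (abs_nonneg T) h2p)
      · rw [ulp_eq_of_abs_lt hsub]
        have h1 : (2 : ℚ) ^ emin ≤ (2 : ℚ) ^ (R + 1 + kb) := zpow_le_zpow_right₀ (by norm_num) (by omega)
        have hMb1 : (1 : ℚ) ≤ |(Mb : ℚ)| := by
          have : Mb ≠ 0 := by rintro rfl; simp [hbrep] at hb0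
          rw [← Int.cast_abs]; exact_mod_cast Int.one_le_abs this
        have h3 : (2 : ℚ) ^ (R + 1 + kb) ≤ (2 : ℚ) ^ (R + 1) * |b| := by
          rw [hbrep, abs_mul, abs_of_pos (zpow_pos h20 _), zpow_add₀ h2 (R + 1) kb]
          have h4 : (0 : ℚ) ≤ 2 ^ (R + 1) * 2 ^ kb := (mul_pos (zpow_pos h20 _) (zpow_pos h20 _)).le
          calc (2 : ℚ) ^ (R + 1) * 2 ^ kb = 2 ^ (R + 1) * 2 ^ kb * 1 := by ring
            _ ≤ 2 ^ (R + 1) * 2 ^ kb * |(Mb : ℚ)| := mul_le_mul_of_nonneg_left hMb1 h4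
            _ = 2 ^ (R + 1) * (|(Mb : ℚ)| * 2 ^ kb) := by ring
        linarith
    have htle : |t| ≤ |T| / 2 := by
      have := abs_sub_fl_le_half_ulp_fl hp hfl (x * b)
      rw [← ht, ← hT] at this; linarith
    have hsum : |Q + t| ≤ |T| := (abs_add_le _ _).trans (by linarith)
    exact abs_fl_le_of_abs_le hfl (isFloat_abs hTF) hsum

/-- **LEMMA 21 (one iteration).** With `eᵢ ≠ 0` a multiple of `2^R`, `|Q₂ᵢ₋₂| ≤ 2^R|b|` (`2^R b` a
float) and `r` ANY integer with `|eᵢ| < 2^r`: "`|eᵢ| ≤ 2^r − 2^R` ... Lines 3, 4, and 5 compute `Q₂ᵢ`,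
an approximation of `Q₂ᵢ₋₂ + eᵢb`, and are subject to roundoff error in Lines 4 and 5 ... `|Q₂ᵢ|`
cannot be larger than `2^r|b|`", and "`|h₂ᵢ₋₁| ≤ 2^(r−1)ulp(b)` is guaranteed by exact rounding
because `h₂ᵢ₋₁` is the roundoff term associated with the computation of `Q₂ᵢ` in Line 5" (here
`ulp(b) = 2^kb` for the fixed representation). PROOF NOTE: the printed argument for the first bound
appeals to "the monotonicity of floating-point multiplication and addition" only; we make it precise
as `|Tᵢ + Q₂ᵢ₋₁| ≤ 2^r|b| + |err(Q₂ᵢ₋₂ ⊕ tᵢ)|` with the Line-4 roundoff `< ½ulp(2^r b)` (Lemma 3(b);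
it vanishes in the subnormal range), whence `|Q₂ᵢ| ≤ 2^r|b|` by `abs_fl_le_of_abs_lt_add_half_ulp`.
Any tie rule, gradual underflow, `p ≥ 1`. [cite: Shewchuk1997, Lemma 21 p. 329] -/
theorem lemma21_step (hp : 1 ≤ p) (hfl : IsRoundNearest p emin fl) {b : ℚ} {Mb kb : ℤ}
    (hbrep : b = (Mb : ℚ) * 2 ^ kb) (hMb : |Mb| < 2 ^ p) {x Q T t : ℚ} {R r : ℤ}
    (hQ : IsFloat p emin Q) (htF : IsFloat p emin t) (hR : emin ≤ R + kb) (hxR : OnGrid R x)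
    (hQR : |Q| ≤ (2 : ℚ) ^ R * |b|) (hx0 : x ≠ 0) (hr : |x| < (2 : ℚ) ^ r) (hT : T = fl (x * b))
    (hTt : T + t = x * b) :
    |fl (T + fl (Q + t))| ≤ (2 : ℚ) ^ r * |b| ∧
      |T + fl (Q + t) - fl (T + fl (Q + t))| ≤ (2 : ℚ) ^ (r + kb - 1) := by
  have h2 : (2 : ℚ) ≠ 0 := by norm_num
  have h20 : (0 : ℚ) < 2 := by norm_num
  have ht : t = x * b - fl (x * b) := by linarith
  have hT' : T = x * b - t := by linarith
  -- R < r, so 2^r·b and 2^(r−1)·b are floats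
  have hRlo : (2 : ℚ) ^ R ≤ |x| := hxR.two_zpow_le_abs hx0
  have hRr : R < r := (zpow_lt_zpow_iff_right₀ (by norm_num : (1 : ℚ) < 2)).mp (hRlo.trans_lt hr)
  have hrk : emin ≤ r + kb := by omega
  -- the float F = 2^r |b| = |M_b|·2^(r+kb)
  have hMbq : |(Mb : ℚ)| < 2 ^ p := by rw [← Int.cast_abs]; exact_mod_cast hMb
  have hbabs : |b| = |(Mb : ℚ)| * 2 ^ kb := by rw [hbrep, abs_mul, abs_of_pos (zpow_pos h20 _)]
  set F : ℚ := (2 : ℚ) ^ r * |b| with hFdef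
  have hFrep : F = |(Mb : ℚ)| * (2 : ℚ) ^ (r + kb) := by rw [hFdef, hbabs, zpow_add₀ h2]; ring
  have hFF : IsFloat p emin F := isFloat_two_zpow_mul_abs hbrep hMb hrk
  have hF0 : 0 ≤ F := by rw [hFdef]; exact mul_nonneg (zpow_pos h20 _).le (abs_nonneg b)
  have h2rk : (0 : ℚ) < (2 : ℚ) ^ (r + kb) := zpow_pos h20 _
  have hFlt : F < (2 : ℚ) ^ ((p : ℤ) + (r + kb)) := by
    rw [hFrep, zpow_add₀ h2 (p : ℤ) (r + kb), zpow_natCast]; exact mul_lt_mul_of_pos_right hMbq h2rk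
  have hFle : F ≤ (2 ^ p - 1) * (2 : ℚ) ^ (r + kb) := by
    rw [hFrep]
    have h1 : |Mb| ≤ 2 ^ p - 1 := by omega
    have : |(Mb : ℚ)| ≤ 2 ^ p - 1 := by rw [← Int.cast_abs]; exact_mod_cast h1
    exact mul_le_mul_of_nonneg_right this h2rk.le
  have hulpF : ulp p emin F ≤ (2 : ℚ) ^ (r + kb) :=
    ulp_le_two_zpow_of_abs_lt hrk (by rwa [abs_of_nonneg hF0])
  -- |eᵢ| ≤ 2^r − 2^R
  have hxle : |x| ≤ (2 : ℚ) ^ r - 2 ^ R := by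
    obtain ⟨ρ, hx⟩ := hxR
    have hG1 : OnGrid R |x| :=
      ⟨|ρ|, by rw [hx, abs_mul, abs_of_pos (zpow_pos h20 _), Int.cast_abs]⟩
    have hG2' : OnGrid r ((2 : ℚ) ^ r) := ⟨1, by simp⟩
    have hG2 : OnGrid R ((2 : ℚ) ^ r) := hG2'.mono hRr.le
    have hpos : (0 : ℚ) < 2 ^ r - |x| := by linarith
    have := (hG2.sub hG1).two_zpow_le_abs hpos.ne'
    rw [abs_of_pos hpos] at this; linarith
  -- |eᵢb + Q| ≤ F, |Tᵢ| ≤ F, |tᵢ| ≤ ½ulp(F), |Q| ≤ F/2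
  have hxbQ : |x * b + Q| ≤ F := by
    have h1 : |x * b| ≤ ((2 : ℚ) ^ r - 2 ^ R) * |b| := by
      rw [abs_mul]; exact mul_le_mul_of_nonneg_right hxle (abs_nonneg b)
    have h3 : F = ((2 : ℚ) ^ r - 2 ^ R) * |b| + 2 ^ R * |b| := by rw [hFdef]; ring
    rw [h3]; exact (abs_add_le _ _).trans (add_le_add h1 hQR)
  have hxbF : |x * b| ≤ F := by
    rw [abs_mul]; exact mul_le_mul_of_nonneg_right hr.le (abs_nonneg b)
  have hTle : |T| ≤ F := by rw [hT]; exact abs_fl_le_of_abs_le hfl hFF hxbF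
  have htle : |t| ≤ ulp p emin F / 2 := by
    have h1 : |t| ≤ ulp p emin T / 2 := by rw [ht, hT]; exact abs_sub_fl_le_half_ulp_fl hp hfl _
    have h3 : ulp p emin T ≤ ulp p emin F := ulp_mono (by rwa [abs_of_nonneg hF0])
    linarith
  have hQle : |Q| ≤ F / 2 := by
    have h1 : (2 : ℚ) ^ R ≤ 2 ^ (r - 1) := zpow_le_zpow_right₀ (by norm_num) (by omega)
    have h3 : (2 : ℚ) ^ (r - 1) = 2 ^ r / 2 := by rw [zpow_sub_one₀ h2]; ring
    calc |Q| ≤ (2 : ℚ) ^ R * |b| := hQR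
      _ ≤ (2 : ℚ) ^ (r - 1) * |b| := mul_le_mul_of_nonneg_right h1 (abs_nonneg b)
      _ = F / 2 := by rw [h3, hFdef]; ring
  -- KEY: |Tᵢ + Q₂ᵢ₋₁| < F + ½ulp(F)
  obtain ⟨u, hu, hFu⟩ := exists_ulp_eq_two_zpow (p := p) (emin := emin) F
  have hSeq : T + fl (Q + t) = (x * b + Q) + (fl (Q + t) - (Q + t)) := by rw [hT']; ring
  have hS : |T + fl (Q + t)| < F + ulp p emin F / 2 := by
    rcases eq_or_lt_of_le hu with hue | hue
    · -- ulp(F) = 2^emin: Q₂ᵢ₋₂ + tᵢ is a float, Line 4 is exact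
      have hgrid : OnGrid emin (Q + t) := (OnGrid.of_isFloat hQ).add (OnGrid.of_isFloat htF)
      have hFsmall : F < (2 : ℚ) ^ p * 2 ^ emin := by
        have := abs_lt_two_pow_mul_ulp (p := p) (emin := emin) F
        rwa [abs_of_nonneg hF0, hFu, ← hue] at this
      have hQt : |Q + t| < (2 : ℚ) ^ (emin + p) := by
        have h1 : |Q + t| ≤ F / 2 + 2 ^ emin / 2 :=
          (abs_add_le _ _).trans (by rw [hFu, ← hue] at htle; exact add_le_add hQle htle)
        have h3 : (2 : ℚ) ^ (emin + p) = 2 ^ p * 2 ^ emin := by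
          rw [zpow_add₀ h2, zpow_natCast]; ring
        have h4 : (2 : ℚ) ^ emin ≤ 2 ^ p * 2 ^ emin :=
          le_mul_of_one_le_left (zpow_pos h20 _).le (one_le_pow₀ (by norm_num))
        rw [h3]; linarith
      have hQtF : IsFloat p emin (Q + t) := isFloat_of_onGrid_of_abs_lt hgrid hQt
      rw [hSeq, fl_eq_self hfl hQtF, sub_self, add_zero]
      linarith [ulp_pos (p := p) (emin := emin) F]
    · -- ulp(F) = 2^u > 2^emin: F = K·2^u with 2^(p−1) ≤ K ≤ 2^p − 1; Lemma 3(b) with i = u − 2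
      obtain ⟨K, hK⟩ := exists_eq_int_mul_ulp_of_isFloat hFF
      rw [hFu] at hK
      have h2u : (0 : ℚ) < (2 : ℚ) ^ u := zpow_pos h20 _
      have hKlt : (K : ℚ) < 2 ^ p := by
        have := abs_lt_two_pow_mul_ulp (p := p) (emin := emin) F
        rw [abs_of_nonneg hF0, hFu, hK] at this
        exact lt_of_mul_lt_mul_right this h2u.le
      have hKle : (K : ℚ) ≤ 2 ^ p - 1 := by
        have hK' : K < 2 ^ p := by exact_mod_cast hKlt
        have : K ≤ 2 ^ p - 1 := by omega
        exact_mod_cast this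
      have hFle' : F ≤ (2 ^ p - 1) * (2 : ℚ) ^ u := by
        rw [hK]; exact mul_le_mul_of_nonneg_right hKle h2u.le
      have hQt : |Q + t| ≤ (2 : ℚ) ^ (u - 2) * (2 ^ (p + 1) + 1) := by
        have h1 : |Q + t| ≤ F / 2 + (2 : ℚ) ^ u / 2 :=
          (abs_add_le _ _).trans (by rw [hFu] at htle; exact add_le_add hQle htle)
        have h3 : (2 : ℚ) ^ (u - 2) * 2 ^ (p + 1) = 2 ^ p * 2 ^ u / 2 := by
          rw [show u - 2 = (u - 1) - 1 by ring, zpow_sub_one₀ h2, zpow_sub_one₀ h2, pow_succ]; ring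
        have h4 : (0 : ℚ) ≤ (2 : ℚ) ^ (u - 2) := (zpow_pos h20 _).le
        nlinarith
      have hδ : |Q + t - fl (Q + t)| ≤ (2 : ℚ) ^ (u - 2) :=
        abs_err_le_two_zpow hp hfl (i := u - 2) (by omega) hQt
      have h5 : (2 : ℚ) ^ (u - 2) < 2 ^ u / 2 := by
        rw [show (2 : ℚ) ^ u / 2 = 2 ^ (u - 1) by rw [zpow_sub_one₀ h2]; ring]
        exact zpow_lt_zpow_right₀ (by norm_num) (by omega)
      rw [hSeq, hFu]
      calc |x * b + Q + (fl (Q + t) - (Q + t))| ≤ |x * b + Q| + |fl (Q + t) - (Q + t)| :=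
            abs_add_le _ _
        _ < F + (2 : ℚ) ^ u / 2 := by rw [abs_sub_comm]; linarith
  refine ⟨abs_fl_le_of_abs_lt_add_half_ulp hp hfl hFF hF0 hS, ?_⟩
  -- the Line-5 roundoff: |Tᵢ + Q₂ᵢ₋₁| < 2^(p + r + kb), so it is at most ½·2^(r+kb)
  have hSlt : |T + fl (Q + t)| < (2 : ℚ) ^ ((p : ℤ) + (r + kb)) := by
    have h3 : (2 : ℚ) ^ ((p : ℤ) + (r + kb)) = 2 ^ p * 2 ^ (r + kb) := by
      rw [zpow_add₀ h2, zpow_natCast]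
    rw [h3]; linarith
  have hulpS := ulp_le_two_zpow_of_abs_lt (p := p) hrk hSlt
  have herr := abs_sub_fl_le_half_ulp hp hfl (T + fl (Q + t))
  rw [show (2 : ℚ) ^ (r + kb - 1) = 2 ^ (r + kb) / 2 by rw [zpow_sub_one₀ h2]; ring]
  linarith


/-! ### §2.6 Theorem 19 -/

/-- **THEOREM 19, the loop (Lines 2–6) from a sound state.** Hypotheses on the state `(Q, [eᵢ, …])`:
`Q` a float and, for every remaining component `e_j`, an exponent `R` with `e_j ∈ 2^R·ℤ`,
`|Q| ≤ 2^R|b|` and `2^R b` a float (the inductive content of Lemma 21: "R is the smallest integer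
such that |eᵢ₋₁| < 2^R; ... |Q₂ᵢ₋₂| ≤ 2^R|b| ... eᵢ must be a multiple of 2^R"). Conclusions: the
output is a `c`-expansion ("each time a component of h is written, that component is smaller than
and does not overlap either the accumulator Q nor any of the remaining products (e_j b); hence, the
component cannot overlap any portion of their sum"), its sum is `Q + Σ e_j b` ("the invariant
Q₂ᵢ + Σ h_j = Σ e_j b"), and its components are floats. `c = 1` (nonoverlapping) for any tie rule
with `RoundoffBelow 1`, `c = 2` (nonadjacent) for a rounding with `RoundoffBelow 2` (round-to-even).
[cite: Shewchuk1997, Thm 19 p. 328–330; Lemma 21 p. 329] -/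
theorem scaleExpansionLoop_spec (hp : 1 ≤ p) (hfl : IsRoundNearest p emin fl) {c : ℚ}
    (hc : c = 1 ∨ c = 2) (hflc : RoundoffBelow c fl) {tp : ℚ → ℚ → ℚ × ℚ} {b : ℚ} {Mb kb : ℤ}
    (hbrep : b = (Mb : ℚ) * 2 ^ kb) (hMb : |Mb| < 2 ^ p) :
    ∀ (es : List ℚ) (Q : ℚ), (∀ x ∈ es, IsFloat p emin x) → (∀ x ∈ es, IsFloat p (emin - kb) x) →
      IsExpansion c es →
      (∀ x ∈ es, (tp x b).1 = fl (x * b) ∧ (tp x b).1 + (tp x b).2 = x * b) →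
      IsFloat p emin Q →
      (∀ y ∈ es, ∃ R : ℤ, emin ≤ R + kb ∧ OnGrid R y ∧ |Q| ≤ (2 : ℚ) ^ R * |b|) →
      IsExpansion c (scaleExpansionLoop tp fl b es Q) ∧
        (scaleExpansionLoop tp fl b es Q).sum = Q + es.sum * b ∧
        ∀ z ∈ scaleExpansionLoop tp fl b es Q, IsFloat p emin z := by
  have hc1 : (1 : ℚ) ≤ c := by rcases hc with rfl | rfl <;> norm_num
  have hc0 : (0 : ℚ) ≤ c := by linarith
  have h2 : (2 : ℚ) ≠ 0 := by norm_num
  intro es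
  induction es with
  | nil =>
    intro Q _ _ _ _ hQ _
    refine ⟨isExpansion_singleton c Q, by simp [scaleExpansionLoop_nil], ?_⟩
    simpa [scaleExpansionLoop_nil] using hQ
  | cons x xs ih =>
    intro Q hF hU hexp htp hQ hinv
    obtain ⟨hxF, hxsF⟩ := List.forall_mem_cons.mp hF
    obtain ⟨hxU, hxsU⟩ := List.forall_mem_cons.mp hU
    obtain ⟨hx1, hxs⟩ := isExpansion_cons.mp hexp
    obtain ⟨⟨hT, hTt⟩, htps⟩ := List.forall_mem_cons.mp htp
    rw [scaleExpansionLoop_cons]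
    set T := (tp x b).1 with hTdef
    set t := (tp x b).2 with htdef
    have ht : t = x * b - fl (x * b) := by linarith
    have hTF : IsFloat p emin T := by rw [hT]; exact (hfl _).1
    have htF : IsFloat p emin t := by
      obtain ⟨Mx, kx, hMx, hkx, hx⟩ := hxU
      have := (isFloat_fl_mul_sub hp hfl hMx hMb (by omega : emin ≤ kx + kb)).neg
      rw [neg_sub, ← hx, ← hbrep, ← ht] at this; exact this
    -- products of the remaining components are 2p-bit numbers on grids ≥ 2^emin
    have hprodF : ∀ w ∈ xs.map (· * b), IsFloat (p + p) emin w := by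
      intro w hw
      obtain ⟨y, hy, rfl⟩ := List.mem_map.mp hw
      exact isFloat_two_mul_prod hbrep hMb (hxsU y hy)
    have htpG : ∀ {g : ℤ}, emin ≤ g → (∀ y ∈ xs, OnGrid g (y * b)) →
        ∀ y ∈ xs, OnGrid g (tp y b).1 ∧ OnGrid g (tp y b).2 := by
      intro g hg hG y hy
      obtain ⟨h1, h12⟩ := htps y hy
      have hG1 : OnGrid g (tp y b).1 := by rw [h1]; exact (hG y hy).fl_of hp hfl hg
      refine ⟨hG1, ?_⟩
      have : (tp y b).2 = y * b - (tp y b).1 := by linarith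
      rw [this]; exact (hG y hy).sub hG1
    set Q₁ := (twoSum fl Q t).1 with hQ₁def
    have hQ₁ : Q₁ = fl (Q + t) := rfl
    set h₁ := (twoSum fl Q t).2 with hh₁def
    have hh₁ : h₁ = Q + t - fl (Q + t) := (twoSum_exact hp hfl hQ htF).1
    set Q₂ := (fastTwoSum fl T Q₁).1 with hQ₂def
    have hQ₂ : Q₂ = fl (T + Q₁) := rfl
    set h₂ := (fastTwoSum fl T Q₁).2 with hh₂def
    have hQ₁F : IsFloat p emin Q₁ := (isFloat_twoSum hfl Q t).1
    have hh₁F : IsFloat p emin h₁ := (isFloat_twoSum hfl Q t).2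
    have hQ₂F : IsFloat p emin Q₂ := (isFloat_fastTwoSum hfl T Q₁).1
    have hh₂F : IsFloat p emin h₂ := (isFloat_fastTwoSum hfl T Q₁).2
    have hfloats : ∀ (rest : List ℚ), (∀ z ∈ rest, IsFloat p emin z) →
        ∀ z ∈ h₁ :: h₂ :: rest, IsFloat p emin z := by
      intro rest hrest z hz
      rcases List.mem_cons.mp hz with rfl | hz
      · exact hh₁F
      rcases List.mem_cons.mp hz with rfl | hz
      · exact hh₂F
      · exact hrest z hz
    by_cases hxb : x * b = 0
    · -- a zero component (or b = 0): "two zero output components are produced, and the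
      -- accumulator value is unchanged"
      have hT0 : T = 0 := by rw [hT, hxb, fl_zero hfl]
      have ht0 : t = 0 := by rw [ht, hxb, fl_zero hfl, sub_zero]
      have hQ₁Q : Q₁ = Q := by rw [hQ₁, ht0, add_zero, fl_eq_self hfl hQ]
      have hh₁0 : h₁ = 0 := by rw [hh₁, ht0, add_zero, fl_eq_self hfl hQ, sub_self]
      have hFTS : fastTwoSum fl T Q₁ = (Q, 0) := by rw [hT0, hQ₁Q]; exact fastTwoSum_zero_left hfl hQ
      have hQ₂Q : Q₂ = Q := by rw [hQ₂def, hFTS]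
      have hh₂0 : h₂ = 0 := by rw [hh₂def, hFTS]
      obtain ⟨ihE, ihS, ihF⟩ :=
        ih Q hxsF hxsU hxs htps hQ (fun y hy => hinv y (List.mem_cons_of_mem x hy))
      rw [hQ₂Q]
      refine ⟨?_, ?_, hfloats _ ihF⟩
      · rw [isExpansion_cons, isExpansion_cons, hh₁0, hh₂0]
        exact ⟨fun z hz => by
            rcases List.mem_cons.mp hz with rfl | hz
            · exact below_zero_right c 0
            · exact below_zero_left (ihF z hz) c,
          fun z hz => below_zero_left (ihF z hz) c, ihE⟩
      · rw [List.sum_cons, List.sum_cons, ihS, hh₁0, hh₂0, List.sum_cons, add_mul, hxb]; ring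
    -- the main case: eᵢ ≠ 0 and b ≠ 0
    have hx0 : x ≠ 0 := fun h => hxb (by rw [h, zero_mul])
    obtain ⟨R, hR, hxR, hQR⟩ := hinv x (List.mem_cons_self)
    have hfts : |Q₁| ≤ |T| := abs_fl_add_le_abs_fst hp hfl hbrep hMb hQ hR hxR hQR hxb hT hTt
    have hh₂ : h₂ = T + Q₁ - fl (T + Q₁) := (fastTwoSum_exact hp hfl hTF hQ₁F hfts).2.2.1
    -- Lemma 21 re-establishes the invariant for Q₂ᵢ
    have hinv' : ∀ y ∈ xs, ∃ R' : ℤ, emin ≤ R' + kb ∧ OnGrid R' y ∧ |Q₂| ≤ (2 : ℚ) ^ R' * |b| := by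
      intro y hy
      obtain ⟨s, hs, hyG, hcs⟩ := (hx1 y hy).normalize (hxsU y hy)
      have hxs' : |x| < (2 : ℚ) ^ s := lt_of_le_of_lt (le_mul_of_one_le_left (abs_nonneg x) hc1) hcs
      exact ⟨s, by omega, hyG,
        (lemma21_step hp hfl hbrep hMb hQ htF hR hxR hQR hx0 hxs' hT hTt).1⟩
    obtain ⟨ihE, ihS, ihF⟩ := ih Q₂ hxsF hxsU hxs htps hQ₂F hinv'
    refine ⟨?_, ?_, hfloats _ ihF⟩
    · rw [isExpansion_cons, isExpansion_cons]
      refine ⟨?_, ?_, ihE⟩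
      · -- h₂ᵢ₋₂ = −err(Q₂ᵢ₋₂ ⊕ tᵢ) lies c-below Q₂ᵢ₋₁, Tᵢ (|h₂ᵢ₋₂| ≤ |tᵢ|, Lemma 1) and every
        -- remaining product (Lemma 20); all later components lie on their common grid
        have hB1 : Below c h₁ Q₁ := twoSum_below hp hfl hflc hQ htF
        have hh₁le : |h₁| ≤ |t| := by
          rw [hh₁, abs_sub_comm]; exact (abs_err_add_le hfl hQ htF).2
        have htT : Below c t T := by rw [ht, hT]; exact hflc (x * b)
        have hB2 : Below c h₁ T := htT.mono_left hc0 hh₁le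
        have hB3 : ∀ w ∈ xs.map (· * b), Below c h₁ w := by
          intro w hw
          obtain ⟨y, hy, rfl⟩ := List.mem_map.mp hw
          exact (below_twoProduct_err_mul hp hfl hc hbrep hMb hxU (hxsU y hy) (hx1 y hy)
            hT hTt).mono_left hc0 hh₁le
        obtain ⟨g₀, hg₀, hQ₁g₀, hcg₀⟩ := hB1.normalize hQ₁F
        have hlistF : ∀ w ∈ T :: xs.map (· * b), IsFloat (p + p) emin w := by
          intro w hw
          rcases List.mem_cons.mp hw with rfl | hw
          · exact isFloat_widen hTF
          · exact hprodF w hw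
        have hlistB : ∀ w ∈ T :: xs.map (· * b), Below c h₁ w := by
          intro w hw
          rcases List.mem_cons.mp hw with rfl | hw
          · exact hB2
          · exact hB3 w hw
        obtain ⟨g, hg, hgg₀, hcg, hG⟩ := exists_common_grid hlistF hlistB hg₀ hcg₀
        have hQ₁g : OnGrid g Q₁ := hQ₁g₀.mono hgg₀
        have hTg : OnGrid g T := hG T List.mem_cons_self
        have hyg : ∀ y ∈ xs, OnGrid g (y * b) := fun y hy =>
          hG _ (List.mem_cons_of_mem _ (List.mem_map.mpr ⟨y, hy, rfl⟩))
        have hQ₂g : OnGrid g Q₂ := (hTg.add hQ₁g).fl_of hp hfl hg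
        have hh₂g : OnGrid g h₂ := by rw [hh₂]; exact (hTg.add hQ₁g).sub hQ₂g
        have hrestg := onGrid_of_mem_scaleExpansionLoop hp hfl hg hQ₂g (htpG hg hyg)
        intro z hz
        rcases List.mem_cons.mp hz with rfl | hz
        · exact ⟨g, hh₂g, hcg⟩
        · exact ⟨g, hrestg z hz, hcg⟩
      · -- h₂ᵢ₋₁ = −err(Tᵢ ⊕ Q₂ᵢ₋₁) lies c-below Q₂ᵢ (FAST-TWO-SUM) and every remaining product
        -- ("|h₂ᵢ₋₁| ≤ 2^(r−1)ulp(b)" while "the remaining products are all multiples of 2^r ulp(b)")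
        have hB1 : Below c h₂ Q₂ := fastTwoSum_below hp hfl hflc hTF hQ₁F hfts
        have hB3 : ∀ w ∈ xs.map (· * b), Below c h₂ w := by
          intro w hw
          obtain ⟨y, hy, rfl⟩ := List.mem_map.mp hw
          obtain ⟨s, hs, ⟨ρ, hyρ⟩, hcs⟩ := (hx1 y hy).normalize (hxsU y hy)
          obtain ⟨r, hxr, -, hcr⟩ := exists_exp_of_gap hc hxU hx0 hs hcs
          have hcore := (lemma21_step hp hfl hbrep hMb hQ htF hR hxR hQR hx0 hxr hT hTt).2
          refine ⟨s + kb, ⟨ρ * Mb, by rw [hyρ, hbrep, zpow_add₀ h2]; push_cast; ring⟩, ?_⟩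
          calc c * |h₂| ≤ c * (2 : ℚ) ^ (r + kb - 1) := by
                rw [hh₂]; exact mul_le_mul_of_nonneg_left hcore hc0
            _ < (2 : ℚ) ^ (s + kb) := hcr
        obtain ⟨g₀, hg₀, hQ₂g₀, hcg₀⟩ := hB1.normalize hQ₂F
        obtain ⟨g, hg, hgg₀, hcg, hG⟩ := exists_common_grid hprodF hB3 hg₀ hcg₀
        have hQ₂g : OnGrid g Q₂ := hQ₂g₀.mono hgg₀
        have hyg : ∀ y ∈ xs, OnGrid g (y * b) := fun y hy =>
          hG _ (List.mem_map.mpr ⟨y, hy, rfl⟩)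
        have hrestg := onGrid_of_mem_scaleExpansionLoop hp hfl hg hQ₂g (htpG hg hyg)
        intro z hz
        exact ⟨g, hrestg z hz, hcg⟩
    · simp only [List.sum_cons]
      rw [ihS, hh₁, hh₂, ← hQ₁, ← hQ₂]
      linear_combination hTt

/-- **THEOREM 19 (SCALE-EXPANSION), for a rounding with `RoundoffBelow c`, `c ∈ {1, 2}`.** "Let
`e = Σ eᵢ` be a nonoverlapping expansion of `m` `p`-bit components, and let `b` be a `p`-bit value
... Then [SCALE-EXPANSION] will produce a nonoverlapping expansion `h` such that
`h = Σ_{i=1}^{2m} hᵢ = be` ... Furthermore, if `e` is nonadjacent and round-to-even tiebreaking is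
used, then `h` is nonadjacent" — with `c = 1` the nonoverlapping statement (any tie rule), with
`c = 2` the nonadjacent one. HYPOTHESES beyond the paper's: the two-product `tp` is exact on the
operands (`Tᵢ = eᵢ ⊗ b`, `Tᵢ + tᵢ = eᵢb`; discharged by `twoProdFMA_exact_of_rep` below or by
Theorem 18), and the no-underflow model of §Lemma 20 (`b = M_b·2^kb`, components in
`F_p ∩ 2^(emin−kb)·F`). Gradual underflow otherwise, `p ≥ 1` (printed: `p ≥ 4`, for TWO-PRODUCT).
[cite: Shewchuk1997, Thm 19 p. 328–330] -/
theorem scaleExpansion_spec (hp : 1 ≤ p) (hfl : IsRoundNearest p emin fl) {c : ℚ}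
    (hc : c = 1 ∨ c = 2) (hflc : RoundoffBelow c fl) {tp : ℚ → ℚ → ℚ × ℚ} {e : List ℚ} {b : ℚ}
    {Mb kb : ℤ} (hbrep : b = (Mb : ℚ) * 2 ^ kb) (hMb : |Mb| < 2 ^ p)
    (he : ∀ x ∈ e, IsFloat p emin x) (heU : ∀ x ∈ e, IsFloat p (emin - kb) x)
    (hexp : IsExpansion c e)
    (htp : ∀ x ∈ e, (tp x b).1 = fl (x * b) ∧ (tp x b).1 + (tp x b).2 = x * b) :
    IsExpansion c (scaleExpansion tp fl e b) ∧ (scaleExpansion tp fl e b).sum = e.sum * b ∧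
      ∀ z ∈ scaleExpansion tp fl e b, IsFloat p emin z := by
  have hc1 : (1 : ℚ) ≤ c := by rcases hc with rfl | rfl <;> norm_num
  have hc0 : (0 : ℚ) ≤ c := by linarith
  cases e with
  | nil => exact ⟨isExpansion_nil c, by simp [scaleExpansion_nil], by simp [scaleExpansion_nil]⟩
  | cons x xs =>
    obtain ⟨hxF, hxsF⟩ := List.forall_mem_cons.mp he
    obtain ⟨hxU, hxsU⟩ := List.forall_mem_cons.mp heU
    obtain ⟨hx1, hxs⟩ := isExpansion_cons.mp hexp
    obtain ⟨⟨hT, hTt⟩, htps⟩ := List.forall_mem_cons.mp htp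
    rw [scaleExpansion_cons]
    set T := (tp x b).1 with hTdef
    set t := (tp x b).2 with htdef
    have ht : t = x * b - fl (x * b) := by linarith
    have hTF : IsFloat p emin T := by rw [hT]; exact (hfl _).1
    have htF : IsFloat p emin t := by
      obtain ⟨Mx, kx, hMx, hkx, hx⟩ := hxU
      have := (isFloat_fl_mul_sub hp hfl hMx hMb (by omega : emin ≤ kx + kb)).neg
      rw [neg_sub, ← hx, ← hbrep, ← ht] at this; exact this
    -- Lemma 21, base case: "|Q₂| ≤ 2^r|b| holds for i = 1 after Line 1 is executed even if Q₂ is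
    -- rounded to a larger magnitude, because |e₁b| < 2^r|b|, and 2^r|b| is expressible in p bits"
    have hinv : ∀ y ∈ xs, ∃ R : ℤ, emin ≤ R + kb ∧ OnGrid R y ∧ |T| ≤ (2 : ℚ) ^ R * |b| := by
      intro y hy
      obtain ⟨s, hs, hyG, hcs⟩ := (hx1 y hy).normalize (hxsU y hy)
      have hxs' : |x| < (2 : ℚ) ^ s := lt_of_le_of_lt (le_mul_of_one_le_left (abs_nonneg x) hc1) hcs
      refine ⟨s, by omega, hyG, ?_⟩
      rw [hT]
      refine abs_fl_le_of_abs_le hfl (isFloat_two_zpow_mul_abs hbrep hMb (by omega)) ?_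
      rw [abs_mul]; exact mul_le_mul_of_nonneg_right hxs'.le (abs_nonneg b)
    obtain ⟨hE, hS, hFl⟩ :=
      scaleExpansionLoop_spec hp hfl hc hflc hbrep hMb xs T hxsF hxsU hxs htps hTF hinv
    refine ⟨?_, ?_, ?_⟩
    · -- "The component h₁, computed by Line 1, does not overlap the remaining products by virtue of
      -- Lemma 20", nor Q₂ = T₁; hence nothing built from them
      rw [isExpansion_cons]
      refine ⟨?_, hE⟩
      have hB2 : Below c t T := by rw [ht, hT]; exact hflc (x * b)
      have hprodF : ∀ w ∈ xs.map (· * b), IsFloat (p + p) emin w := by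
        intro w hw
        obtain ⟨y, hy, rfl⟩ := List.mem_map.mp hw
        exact isFloat_two_mul_prod hbrep hMb (hxsU y hy)
      have hB3 : ∀ w ∈ xs.map (· * b), Below c t w := by
        intro w hw
        obtain ⟨y, hy, rfl⟩ := List.mem_map.mp hw
        exact below_twoProduct_err_mul hp hfl hc hbrep hMb hxU (hxsU y hy) (hx1 y hy) hT hTt
      obtain ⟨g₀, hg₀, hTg₀, hcg₀⟩ := hB2.normalize hTF
      obtain ⟨g, hg, hgg₀, hcg, hG⟩ := exists_common_grid hprodF hB3 hg₀ hcg₀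
      have hTg : OnGrid g T := hTg₀.mono hgg₀
      have hyg : ∀ y ∈ xs, OnGrid g (y * b) := fun y hy => hG _ (List.mem_map.mpr ⟨y, hy, rfl⟩)
      have htpG : ∀ y ∈ xs, OnGrid g (tp y b).1 ∧ OnGrid g (tp y b).2 := by
        intro y hy
        obtain ⟨h1, h12⟩ := htps y hy
        have hG1 : OnGrid g (tp y b).1 := by rw [h1]; exact (hyg y hy).fl_of hp hfl hg
        refine ⟨hG1, ?_⟩
        have : (tp y b).2 = y * b - (tp y b).1 := by linarith
        rw [this]; exact (hyg y hy).sub hG1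
      have hrestg := onGrid_of_mem_scaleExpansionLoop hp hfl hg hTg htpG
      intro z hz
      exact ⟨g, hrestg z hz, hcg⟩
    · rw [List.sum_cons, hS, List.sum_cons]; linear_combination hTt
    · intro z hz
      rcases List.mem_cons.mp hz with rfl | hz
      · exact htF
      · exact hFl z hz

/-- **THEOREM 19, nonoverlapping clause, any tie rule**: for ANY round-to-nearest `fl` (`p ≥ 1`), an
exact two-product on the operands and the no-underflow model, SCALE-EXPANSION of a nonoverlapping
increasing-up-to-zeros expansion of floats (`IsExpansion 1 e`) is a nonoverlapping
increasing-up-to-zeros expansion of `2m` floats with `Σ hᵢ = b·Σ eᵢ`.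
[cite: Shewchuk1997, Thm 19 p. 328] -/
theorem scaleExpansion_nonoverlapping (hp : 1 ≤ p) (hfl : IsRoundNearest p emin fl)
    {tp : ℚ → ℚ → ℚ × ℚ} {e : List ℚ} {b : ℚ} {Mb kb : ℤ} (hbrep : b = (Mb : ℚ) * 2 ^ kb)
    (hMb : |Mb| < 2 ^ p) (he : ∀ x ∈ e, IsFloat p emin x) (heU : ∀ x ∈ e, IsFloat p (emin - kb) x)
    (hexp : IsExpansion 1 e)
    (htp : ∀ x ∈ e, (tp x b).1 = fl (x * b) ∧ (tp x b).1 + (tp x b).2 = x * b) :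
    IsExpansion 1 (scaleExpansion tp fl e b) ∧ (scaleExpansion tp fl e b).sum = e.sum * b ∧
      (∀ z ∈ scaleExpansion tp fl e b, IsFloat p emin z) ∧
      (scaleExpansion tp fl e b).length = 2 * e.length :=
  let h := scaleExpansion_spec hp hfl (Or.inl rfl) (roundoffBelow_one hp hfl) hbrep hMb he heU hexp htp
  ⟨h.1, h.2.1, h.2.2, length_scaleExpansion tp fl e b⟩

/-- **THEOREM 19, "Furthermore, if e is nonadjacent and round-to-even tiebreaking is used, then h
is nonadjacent"** (IEEE 754 default rounding `roundTiesEven`, `p ≥ 1`, exact two-product on the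
operands, no-underflow model). [cite: Shewchuk1997, Thm 19 p. 328] -/
theorem scaleExpansion_nonadjacent (hp : 1 ≤ p) {tp : ℚ → ℚ → ℚ × ℚ} {e : List ℚ} {b : ℚ}
    {Mb kb : ℤ} (hbrep : b = (Mb : ℚ) * 2 ^ kb) (hMb : |Mb| < 2 ^ p)
    (he : ∀ x ∈ e, IsFloat p emin x) (heU : ∀ x ∈ e, IsFloat p (emin - kb) x)
    (hexp : IsExpansion 2 e)
    (htp : ∀ x ∈ e, (tp x b).1 = roundTiesEven p emin (x * b) ∧
      (tp x b).1 + (tp x b).2 = x * b) :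
    IsExpansion 2 (scaleExpansion tp (roundTiesEven p emin) e b) ∧
      (scaleExpansion tp (roundTiesEven p emin) e b).sum = e.sum * b ∧
      (∀ z ∈ scaleExpansion tp (roundTiesEven p emin) e b, IsFloat p emin z) ∧
      (scaleExpansion tp (roundTiesEven p emin) e b).length = 2 * e.length :=
  let h := scaleExpansion_spec hp (isRoundNearest_roundTiesEven hp) (Or.inr rfl)
    (roundoffBelow_two_roundTiesEven p emin) hbrep hMb he heU hexp htp
  ⟨h.1, h.2.1, h.2.2, length_scaleExpansion tp _ e b⟩

/-- **DICTIONARY FORM of Theorem 19 (nonoverlapping clause)**: in the paper's own words — input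
components pairwise nonoverlapping and "sorted in order of increasing magnitude, except that any of
the eᵢ may be zero"; output likewise, with `Σ hᵢ = b Σ eᵢ`. [cite: Shewchuk1997, Thm 19 p. 328] -/
theorem scaleExpansion_pairwise_nonoverlapping (hp : 1 ≤ p) (hfl : IsRoundNearest p emin fl)
    {tp : ℚ → ℚ → ℚ × ℚ} {e : List ℚ} {b : ℚ} {Mb kb : ℤ} (hbrep : b = (Mb : ℚ) * 2 ^ kb)
    (hMb : |Mb| < 2 ^ p) (he : ∀ x ∈ e, IsFloat p emin x) (heU : ∀ x ∈ e, IsFloat p (emin - kb) x)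
    (hno : e.Pairwise Nonoverlapping) (hinc : e.Pairwise (fun x y => x = 0 ∨ y = 0 ∨ |x| < |y|))
    (htp : ∀ x ∈ e, (tp x b).1 = fl (x * b) ∧ (tp x b).1 + (tp x b).2 = x * b) :
    (scaleExpansion tp fl e b).Pairwise Nonoverlapping ∧
      (scaleExpansion tp fl e b).Pairwise (fun x y => x = 0 ∨ y = 0 ∨ |x| < |y|) ∧
      (scaleExpansion tp fl e b).sum = e.sum * b := by
  obtain ⟨hE, hS, hF, -⟩ := scaleExpansion_nonoverlapping hp hfl hbrep hMb he heU
    ((isExpansion_one_iff he).mpr ⟨hno, hinc⟩) htp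
  exact ⟨((isExpansion_one_iff hF).mp hE).1, ((isExpansion_one_iff hF).mp hE).2, hS⟩

/-! ### An exact two-product for Line 1 / Line 3: the FMA-based `twoProdFMA` [BoldoEtAl2023, Alg. 3]

Shewchuk's TWO-PRODUCT (Theorem 18, Dekker's algorithm with SPLIT) is one way to obtain
`(x, y) = (a ⊗ b, ab − a ⊗ b)`; on hardware with a fused multiply-add the same pair is
`(RN(ab), RN(ab − RN(ab)))`. Either discharges the hypothesis `htp` of Theorem 19. -/

/-- The FMA two-product is exact on the operands of SCALE-EXPANSION in the no-underflow model:
`x = a ⊗ b` and `x + y = ab` [BoldoEtAl2023, Property 2.12 / Algorithm 3].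
[cite: Shewchuk1997, Thm 18 p. 326 ("x + y = ab"); Thm 19 p. 328 (Lines 1, 3)] -/
theorem twoProdFMA_exact_of_rep (hp : 1 ≤ p) (hfl : IsRoundNearest p emin fl) {b : ℚ}
    {Mb kb : ℤ} (hbrep : b = (Mb : ℚ) * 2 ^ kb) (hMb : |Mb| < 2 ^ p) {a : ℚ}
    (haU : IsFloat p (emin - kb) a) :
    (twoProdFMA fl a b).1 = fl (a * b) ∧ (twoProdFMA fl a b).1 + (twoProdFMA fl a b).2 = a * b := by
  obtain ⟨Ma, ka, hMa, hka, rfl⟩ := haU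
  refine ⟨rfl, ?_⟩
  rw [hbrep]
  exact (twoProdFMA_correct hp hfl hMa hMb (by omega : emin ≤ ka + kb)).2

/-- **THEOREM 19 with the FMA two-product**, any tie rule: `SCALE-EXPANSION(e, b)` computed with
`twoProdFMA` is a nonoverlapping increasing-up-to-zeros expansion of `2m` floats equal to `b·Σeᵢ`.
[cite: Shewchuk1997, Thm 19 p. 328] -/
theorem scaleExpansion_twoProdFMA_nonoverlapping (hp : 1 ≤ p) (hfl : IsRoundNearest p emin fl)
    {e : List ℚ} {b : ℚ} {Mb kb : ℤ} (hbrep : b = (Mb : ℚ) * 2 ^ kb) (hMb : |Mb| < 2 ^ p)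
    (he : ∀ x ∈ e, IsFloat p emin x) (heU : ∀ x ∈ e, IsFloat p (emin - kb) x)
    (hexp : IsExpansion 1 e) :
    IsExpansion 1 (scaleExpansion (twoProdFMA fl) fl e b) ∧
      (scaleExpansion (twoProdFMA fl) fl e b).sum = e.sum * b ∧
      (∀ z ∈ scaleExpansion (twoProdFMA fl) fl e b, IsFloat p emin z) ∧
      (scaleExpansion (twoProdFMA fl) fl e b).length = 2 * e.length :=
  scaleExpansion_nonoverlapping hp hfl hbrep hMb he heU hexp
    (fun x hx => twoProdFMA_exact_of_rep hp hfl hbrep hMb (heU x hx))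

/-- **THEOREM 19 with the FMA two-product, round-to-even**: a nonadjacent input gives a nonadjacent
output. [cite: Shewchuk1997, Thm 19 p. 328] -/
theorem scaleExpansion_twoProdFMA_nonadjacent (hp : 1 ≤ p) {e : List ℚ} {b : ℚ} {Mb kb : ℤ}
    (hbrep : b = (Mb : ℚ) * 2 ^ kb) (hMb : |Mb| < 2 ^ p) (he : ∀ x ∈ e, IsFloat p emin x)
    (heU : ∀ x ∈ e, IsFloat p (emin - kb) x) (hexp : IsExpansion 2 e) :
    IsExpansion 2 (scaleExpansion (twoProdFMA (roundTiesEven p emin)) (roundTiesEven p emin) e b) ∧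
      (scaleExpansion (twoProdFMA (roundTiesEven p emin)) (roundTiesEven p emin) e b).sum
          = e.sum * b ∧
      (∀ z ∈ scaleExpansion (twoProdFMA (roundTiesEven p emin)) (roundTiesEven p emin) e b,
          IsFloat p emin z) ∧
      (scaleExpansion (twoProdFMA (roundTiesEven p emin)) (roundTiesEven p emin) e b).length
          = 2 * e.length :=
  scaleExpansion_nonadjacent hp hbrep hMb he heU hexp
    (fun x hx => twoProdFMA_exact_of_rep hp (isRoundNearest_roundTiesEven hp) hbrep hMb (heU x hx))


/-! ### §2.5 SPLIT and TWO-PRODUCT (Theorems 17 and 18), by dictionary with [BoldoMelquiond2017]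

Shewchuk's SPLIT is Veltkamp's splitting ([BoldoMelquiond2017] Algorithm 5.4, `veltkampSplit`) with
Line 2 written `abig ⇐ c ⊖ a` instead of `q ⇐ ◦(a − c)`: `abig = −q` for the mirrored rounding
`t ↦ −fl(−t)` at that line, so `SPLIT(a, s) = veltkampSplit fl (t ↦ −fl(−t)) fl fl s a` for every `fl`
(`split_eq_veltkampSplit_mirror`), and `= veltkampSplit fl fl fl fl s a` when `fl` is odd — both
IEEE 754 round-to-nearest attributes are (`roundTiesEven_neg`). TWO-PRODUCT is Dekker's product
([BoldoMelquiond2017] Algorithm 5.5, `dekkerProduct`) with the operands swapped (Shewchuk subtracts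
`alo ⊗ bhi` before `ahi ⊗ blo`), the partial sums negated (`errᵢ = −tᵢ`) and the same last line; for
an odd `fl` the outputs coincide: `TWO-PRODUCT(a, b) = (a ⊗ b, (dekkerProduct fl s b a).2)`
(`twoProduct_snd_eq_dekkerProduct_snd`). Theorem 17 is then [BoldoMelquiond2017] Theorems 5.18–5.19
and Theorem 18 is Lemma 5.23 (`lemma_5_23`, radix 2, `p ≤ 2s ≤ p + 1`, i.e. `s = ⌈p/2⌉`). -/

/-- **SPLIT(a, s)** [Dekker]: `c ⇐ (2^s + 1) ⊗ a; abig ⇐ c ⊖ a; ahi ⇐ c ⊖ abig; alo ⇐ a ⊖ ahi;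
return (ahi, alo)`. [cite: Shewchuk1997, Thm 17 p. 325 (SPLIT)] -/
def split (fl : ℚ → ℚ) (s : ℕ) (a : ℚ) : ℚ × ℚ :=
  let c := fl ((2 ^ s + 1) * a)
  let abig := fl (c - a)
  let ahi := fl (c - abig)
  (ahi, fl (a - ahi))

/-- Unfolding of SPLIT. [cite: Shewchuk1997, Thm 17 p. 325 (SPLIT)] -/
theorem split_eq (fl : ℚ → ℚ) (s : ℕ) (a : ℚ) :
    split fl s a = (fl (fl ((2 ^ s + 1) * a) - fl (fl ((2 ^ s + 1) * a) - a)),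
      fl (a - fl (fl ((2 ^ s + 1) * a) - fl (fl ((2 ^ s + 1) * a) - a)))) := rfl

/-- DICTIONARY: `SPLIT(a, s)` is Veltkamp's Algorithm 5.4 with the mirrored rounding `t ↦ −fl(−t)` at
Line 2 (`abig = c ⊖ a = −◦'(a − c)`). [cite: Shewchuk1997, Thm 17 p. 325 (SPLIT)]
[cite: BoldoMelquiond2017, §5.2.1.1 Algorithm 5.4] -/
theorem split_eq_veltkampSplit_mirror (fl : ℚ → ℚ) (s : ℕ) (a : ℚ) :
    split fl s a = veltkampSplit fl (fun t => -fl (-t)) fl fl s a := by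
  rw [split_eq, veltkampSplit_eq]
  have h : -(a - fl ((2 ^ s + 1) * a)) = fl ((2 ^ s + 1) * a) - a := by ring
  simp only [h, ← sub_eq_add_neg]

/-- DICTIONARY, odd rounding (`fl(−t) = −fl(t)`, e.g. `roundTiesEven`): `SPLIT(a, s)` is Veltkamp's
Algorithm 5.4 verbatim. [cite: Shewchuk1997, Thm 17 p. 325 (SPLIT)]
[cite: BoldoMelquiond2017, §5.2.1.1 Algorithm 5.4] -/
theorem split_eq_veltkampSplit (hodd : ∀ t, fl (-t) = -fl t) (s : ℕ) (a : ℚ) :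
    split fl s a = veltkampSplit fl fl fl fl s a := by
  rw [split_eq_veltkampSplit_mirror]
  have hfun : (fun t => -fl (-t)) = fl := funext fun t => by rw [hodd, neg_neg]
  rw [hfun]

/-- **THEOREM 17 (SPLIT)** [Dekker], for ANY round-to-nearest `fl` (tie rule free), `p ≥ 4`,
`2 ≤ s ≤ p − 2`, `a ∈ F` (subnormal `a` allowed): "the following algorithm will produce a
`(p − s)`-bit value `ahi` and a[n] `(s − 1)`-bit value `alo` such that ... `a = ahi + alo`"; moreover
`alo = L·ulp(a)` with `|L| ≤ 2^(s−1)` and `ahi` is a nearest `(p − s)`-bit float to `a`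
([BoldoMelquiond2017] Theorems 5.18–5.19 through the dictionary). The printed range is `p ≥ 3`,
`p/2 ≤ s ≤ p − 1`; the case `s = p − 1` is NOT covered here. For "nonoverlapping" and `|ahi| ≥ |alo|`
see `split_below`. [cite: Shewchuk1997, Thm 17 p. 325–326]
[cite: BoldoMelquiond2017, Theorem 5.18, Theorem 5.19] -/
theorem split_spec (hp : 4 ≤ p) {s : ℕ} (hs : 2 ≤ s) (hsp : s + 2 ≤ p)
    (hfl : IsRoundNearest p emin fl) {a : ℚ} (ha : IsFloat p emin a) :
    a = (split fl s a).1 + (split fl s a).2 ∧ IsFloat (p - s) emin (split fl s a).1 ∧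
      IsFloat (s - 1) emin (split fl s a).2 ∧
      (∃ L : ℤ, (split fl s a).2 = (L : ℚ) * ulp p emin a ∧ |L| ≤ 2 ^ (s - 1)) ∧
      ∀ f : ℚ, IsFloat (p - s) emin f → |a - (split fl s a).1| ≤ |a - f| := by
  rw [split_eq_veltkampSplit_mirror]
  obtain ⟨hsum, hhi, hlo, ⟨L, hL, hLle⟩, hnear⟩ :=
    theorem_5_18_5_19 hp hs hsp hfl hfl.neg hfl hfl ha
  exact ⟨hsum, hhi, hlo, ⟨L, by rw [← hL]; linarith, hLle⟩, hnear⟩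

/-- **THEOREM 17, "a nonoverlapping (s − 1)-bit value alo such that |ahi| ≥ |alo|"**, for an odd
round-to-nearest `fl` and a NORMAL `a` (`|a| ≥ 2^(emin+p−1)`): in the binade `2^e ≤ |a| < 2^(e+1)`
with quantum `q = e − p + 1`, `ahi = K·2^(q+s)` and `alo = L·2^q`, `|L| ≤ 2^(s−1)` ("its least
significant bit cannot be smaller than ulp(abig) = 2^s ulp(a)"), hence `alo` lies nonoverlapping
below `ahi` (`Below 1 alo ahi`) and `|alo| ≤ |ahi|`. [cite: Shewchuk1997, Thm 17 p. 325–326]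
[cite: BoldoMelquiond2017, §5.2.2.1 (second paragraph)] -/
theorem split_below (hp : 4 ≤ p) {s : ℕ} (hs : 2 ≤ s) (hsp : s + 2 ≤ p)
    (hfl : IsRoundNearest p emin fl) (hodd : ∀ t, fl (-t) = -fl t) {a : ℚ} (ha : IsFloat p emin a)
    (han : (2 : ℚ) ^ (emin + p - 1) ≤ |a|) :
    Below 1 (split fl s a).2 (split fl s a).1 ∧ |(split fl s a).2| ≤ |(split fl s a).1| ∧
      a = (split fl s a).1 + (split fl s a).2 := by
  have h2 : (0 : ℚ) < 2 := by norm_num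
  have h2ne : (2 : ℚ) ≠ 0 := by norm_num
  have ha0 : a ≠ 0 := by
    intro h; rw [h, abs_zero] at han; linarith [zpow_pos h2 (emin + p - 1)]
  obtain ⟨e, hea, hea'⟩ : ∃ e : ℤ, (2 : ℚ) ^ e ≤ |a| ∧ |a| < (2 : ℚ) ^ (e + 1) :=
    ⟨_, zpow_log_le_abs ha0, abs_lt_zpow_log_succ a⟩
  have hq : emin ≤ e - p + 1 := by
    by_contra hc
    have h := zpow_le_zpow_right₀ (show (1 : ℚ) ≤ 2 by norm_num) (show e + 1 ≤ emin + p - 1 by omega)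
    linarith
  rw [split_eq_veltkampSplit hodd]
  obtain ⟨K, L, hK, -, hL, hLle, hsum⟩ := veltkamp_RN_binade hp hs hsp hfl ha hea hea' hq
  set ahi := (veltkampSplit fl fl fl fl s a).1
  set alo := (veltkampSplit fl fl fl fl s a).2
  -- |alo| ≤ 2^(s−1)·2^q = 2^(q+s−1)
  have hs1 : ((s - 1 : ℕ) : ℤ) = (s : ℤ) - 1 := by omega
  have hLle' : |(L : ℚ)| ≤ (2 : ℚ) ^ ((s : ℤ) - 1) := by rw [← hs1, zpow_natCast]; exact hLle
  have hLq : |alo| ≤ (2 : ℚ) ^ (e - p + 1 + (s - 1)) :=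
    calc |alo| = |(L : ℚ)| * (2 : ℚ) ^ (e - p + 1) := by rw [hL, abs_mul, abs_of_pos (zpow_pos h2 _)]
      _ ≤ (2 : ℚ) ^ ((s : ℤ) - 1) * (2 : ℚ) ^ (e - p + 1) :=
          mul_le_mul_of_nonneg_right hLle' (zpow_pos h2 _).le
      _ = (2 : ℚ) ^ (e - p + 1 + (s - 1)) := by
          rw [zpow_add₀ h2ne (e - p + 1) ((s : ℤ) - 1), mul_comm]
  refine ⟨⟨e - p + 1 + s, ⟨K, hK⟩, ?_⟩, ?_, hsum⟩
  · rw [one_mul]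
    calc |alo| ≤ (2 : ℚ) ^ (e - p + 1 + (s - 1)) := hLq
      _ < (2 : ℚ) ^ (e - p + 1 + s) := zpow_lt_zpow_right₀ (by norm_num) (by omega)
  · -- |ahi| ≥ |a| − |alo| ≥ 2^e − 2^(q+s−1) ≥ 2^(q+s−1) ≥ |alo|  (s ≤ p − 2)
    have hpow : (2 : ℚ) ^ (e - p + 1 + (s - 1)) ≤ (2 : ℚ) ^ (e - 1) :=
      zpow_le_zpow_right₀ (by norm_num) (by omega)
    have he1 : (2 : ℚ) ^ e = 2 * (2 : ℚ) ^ (e - 1) := by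
      rw [show e = e - 1 + 1 by ring, zpow_add_one₀ h2ne]; ring_nf
    have htri : |a| - |alo| ≤ |ahi| := by
      have := abs_sub_abs_le_abs_sub a alo
      rw [show a - alo = ahi by rw [hsum]; ring] at this
      exact this
    linarith

/-- **TWO-PRODUCT(a, b)** [Veltkamp–Dekker]: `x ⇐ a ⊗ b; (ahi, alo) = SPLIT(a, s);
(bhi, blo) = SPLIT(b, s); err₁ ⇐ x ⊖ (ahi ⊗ bhi); err₂ ⇐ err₁ ⊖ (alo ⊗ bhi);
err₃ ⇐ err₂ ⊖ (ahi ⊗ blo); y ⇐ (alo ⊗ blo) ⊖ err₃; return (x, y)` (printed with `s = ⌈p/2⌉`).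
[cite: Shewchuk1997, Thm 18 p. 326 (TWO-PRODUCT)] -/
def twoProduct (fl : ℚ → ℚ) (s : ℕ) (a b : ℚ) : ℚ × ℚ :=
  let x := fl (a * b)
  let ahi := (split fl s a).1
  let alo := (split fl s a).2
  let bhi := (split fl s b).1
  let blo := (split fl s b).2
  let err1 := fl (x - fl (ahi * bhi))
  let err2 := fl (err1 - fl (alo * bhi))
  let err3 := fl (err2 - fl (ahi * blo))
  (x, fl (fl (alo * blo) - err3))

/-- `x = a ⊗ b`. [cite: Shewchuk1997, Thm 18 p. 326 (TWO-PRODUCT, Line 1)] -/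
theorem twoProduct_fst (fl : ℚ → ℚ) (s : ℕ) (a b : ℚ) : (twoProduct fl s a b).1 = fl (a * b) := rfl

/-- Unfolding of `y`. [cite: Shewchuk1997, Thm 18 p. 326 (TWO-PRODUCT, Lines 4–7)] -/
theorem twoProduct_snd (fl : ℚ → ℚ) (s : ℕ) (a b : ℚ) :
    (twoProduct fl s a b).2 =
      fl (fl ((split fl s a).2 * (split fl s b).2) -
        fl (fl (fl (fl (a * b) - fl ((split fl s a).1 * (split fl s b).1)) -
              fl ((split fl s a).2 * (split fl s b).1)) -
            fl ((split fl s a).1 * (split fl s b).2))) := rfl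

/-- DICTIONARY, odd rounding: `errᵢ = −tᵢ` (`i = 1, 2, 3`) and `y = r_ℓ` for Dekker's Algorithm 5.5
run on `(b, a)`: `TWO-PRODUCT(a, b).2 = (dekkerProduct fl s b a).2`.
[cite: Shewchuk1997, Thm 18 p. 326 (TWO-PRODUCT)] [cite: BoldoMelquiond2017, §5.2.2 Algorithm 5.5] -/
theorem twoProduct_snd_eq_dekkerProduct_snd (hodd : ∀ t, fl (-t) = -fl t) (s : ℕ) (a b : ℚ) :
    (twoProduct fl s a b).2 = (dekkerProduct fl s b a).2 := by
  rw [twoProduct_snd, dekkerProduct_snd, ← split_eq_veltkampSplit hodd s a,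
    ← split_eq_veltkampSplit hodd s b]
  set ahi := (split fl s a).1
  set alo := (split fl s a).2
  set bhi := (split fl s b).1
  set blo := (split fl s b).2
  rw [mul_comm b a, mul_comm bhi ahi, mul_comm bhi alo, mul_comm blo ahi, mul_comm blo alo]
  set t1 := fl (-fl (a * b) + fl (ahi * bhi))
  set t2 := fl (t1 + fl (alo * bhi))
  set t3 := fl (t2 + fl (ahi * blo))
  have e1 : fl (fl (a * b) - fl (ahi * bhi)) = -t1 := by
    rw [show fl (a * b) - fl (ahi * bhi) = -(-fl (a * b) + fl (ahi * bhi)) by ring, hodd]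
  have e2 : fl (fl (fl (a * b) - fl (ahi * bhi)) - fl (alo * bhi)) = -t2 := by
    rw [e1, show -t1 - fl (alo * bhi) = -(t1 + fl (alo * bhi)) by ring, hodd]
  have e3 : fl (fl (fl (fl (a * b) - fl (ahi * bhi)) - fl (alo * bhi)) - fl (ahi * blo)) = -t3 := by
    rw [e2, show -t2 - fl (ahi * blo) = -(t2 + fl (ahi * blo)) by ring, hodd]
  rw [e3, sub_neg_eq_add, add_comm]

/-- **THEOREM 18 (TWO-PRODUCT)** [Veltkamp–Dekker], radix 2, for an ODD round-to-nearest `fl` (either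
IEEE 754 round-to-nearest attribute) with `RoundoffBelow c` (`c = 1`: any tie rule; `c = 2`:
round-to-even), `p ≥ 4`, `p ≤ 2s ≤ p + 1` (`s = ⌈p/2⌉`), `a, b ∈ F`, and NO UNDERFLOW in the sense of
[BoldoMelquiond2017] Lemma 5.23 (`ab = 0`, or `a`, `b` normal with `|ab| ≥ 2^(emin+2p−1)`): "the
following algorithm will produce a nonoverlapping expansion `x + y` such that `ab = x + y`, where `x`
is an approximation to `ab` and `y` represents the roundoff error in the calculation of `x`.
Furthermore, if round-to-even tiebreaking is used, `x` and `y` are nonadjacent": `x = a ⊗ b`,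
`x + y = ab`, `y ∈ F`, and `y` lies `c`-below `x`. Printed: `p ≥ 6`.
[cite: Shewchuk1997, Thm 18 p. 326–327] [cite: BoldoMelquiond2017, Lemma 5.23 (β = 2)] -/
theorem twoProduct_spec (hp : 4 ≤ p) {s : ℕ} (hs2 : p ≤ 2 * s) (hs2' : 2 * s ≤ p + 1)
    (hfl : IsRoundNearest p emin fl) (hodd : ∀ t, fl (-t) = -fl t) {c : ℚ} (hflc : RoundoffBelow c fl)
    {a b : ℚ} (ha : IsFloat p emin a) (hb : IsFloat p emin b)
    (hab : a * b = 0 ∨ ((2 : ℚ) ^ (emin + p - 1) ≤ |a| ∧ (2 : ℚ) ^ (emin + p - 1) ≤ |b| ∧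
      (2 : ℚ) ^ (emin + 2 * p - 1) ≤ |a * b|)) :
    (twoProduct fl s a b).1 = fl (a * b) ∧
      (twoProduct fl s a b).1 + (twoProduct fl s a b).2 = a * b ∧
      IsFloat p emin (twoProduct fl s a b).2 ∧
      Below c (twoProduct fl s a b).2 (twoProduct fl s a b).1 ∧
      IsExpansion c [(twoProduct fl s a b).2, (twoProduct fl s a b).1] := by
  have hsum : (twoProduct fl s a b).1 + (twoProduct fl s a b).2 = a * b := by
    rw [twoProduct_fst, twoProduct_snd_eq_dekkerProduct_snd hodd s a b]
    have hba : b * a = 0 ∨ ((2 : ℚ) ^ (emin + p - 1) ≤ |b| ∧ (2 : ℚ) ^ (emin + p - 1) ≤ |a| ∧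
        (2 : ℚ) ^ (emin + 2 * p - 1) ≤ |b * a|) := by
      rcases hab with h | ⟨h1, h2, h3⟩
      · exact Or.inl (by rw [mul_comm]; exact h)
      · exact Or.inr ⟨h2, h1, by rw [mul_comm b a]; exact h3⟩
    have h := lemma_5_23 hp hs2 hs2' hfl hb ha hba
    rw [dekkerProduct_fst, mul_comm b a] at h
    linarith
  have hyF : IsFloat p emin (twoProduct fl s a b).2 := by rw [twoProduct_snd]; exact (hfl _).1
  have hy : (twoProduct fl s a b).2 = a * b - fl (a * b) := by
    rw [twoProduct_fst] at hsum; linarith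
  have hB : Below c (twoProduct fl s a b).2 (twoProduct fl s a b).1 := by
    rw [hy, twoProduct_fst]; exact hflc (a * b)
  refine ⟨rfl, hsum, hyF, hB, ?_⟩
  exact isExpansion_cons.mpr ⟨fun z hz => by rw [List.mem_singleton.mp hz]; exact hB,
    isExpansion_singleton c _⟩

/-- **THEOREM 18, round-to-even**: with `roundTiesEven`, `x` and `y` are nonadjacent.
[cite: Shewchuk1997, Thm 18 p. 326 ("Furthermore, if round-to-even tiebreaking is used")] -/
theorem twoProduct_nonadjacent (hp : 4 ≤ p) {s : ℕ} (hs2 : p ≤ 2 * s) (hs2' : 2 * s ≤ p + 1)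
    {a b : ℚ} (ha : IsFloat p emin a) (hb : IsFloat p emin b)
    (hab : a * b = 0 ∨ ((2 : ℚ) ^ (emin + p - 1) ≤ |a| ∧ (2 : ℚ) ^ (emin + p - 1) ≤ |b| ∧
      (2 : ℚ) ^ (emin + 2 * p - 1) ≤ |a * b|)) :
    (twoProduct (roundTiesEven p emin) s a b).1 + (twoProduct (roundTiesEven p emin) s a b).2
        = a * b ∧
      Nonadjacent (twoProduct (roundTiesEven p emin) s a b).2
        (twoProduct (roundTiesEven p emin) s a b).1 := by
  obtain ⟨-, hsum, -, hB, -⟩ := twoProduct_spec hp hs2 hs2' (isRoundNearest_roundTiesEven (by omega))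
    roundTiesEven_neg (roundoffBelow_two_roundTiesEven p emin) ha hb hab
  exact ⟨hsum, hB.nonadjacent⟩

/-- **THEOREM 19 with Shewchuk's own TWO-PRODUCT at Lines 1 and 3** (odd round-to-nearest `fl`,
any tie rule; `p ≥ 4`, `s = ⌈p/2⌉`): under the no-underflow model of this file AND Lemma 5.23's
(every `eᵢb` zero or a product of normal numbers `≥ 2^(emin+2p−1)` in magnitude), SCALE-EXPANSION
yields a nonoverlapping increasing-up-to-zeros expansion of `2m` floats equal to `b·Σeᵢ`.
[cite: Shewchuk1997, Thm 19 p. 328; Thm 18 p. 326] -/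
theorem scaleExpansion_twoProduct_nonoverlapping (hp : 4 ≤ p) {s : ℕ} (hs2 : p ≤ 2 * s)
    (hs2' : 2 * s ≤ p + 1) (hfl : IsRoundNearest p emin fl) (hodd : ∀ t, fl (-t) = -fl t)
    {e : List ℚ} {b : ℚ} {Mb kb : ℤ} (hbrep : b = (Mb : ℚ) * 2 ^ kb) (hMb : |Mb| < 2 ^ p)
    (hbF : IsFloat p emin b) (he : ∀ x ∈ e, IsFloat p emin x)
    (heU : ∀ x ∈ e, IsFloat p (emin - kb) x) (hexp : IsExpansion 1 e)
    (hnf : ∀ x ∈ e, x * b = 0 ∨ ((2 : ℚ) ^ (emin + p - 1) ≤ |x| ∧ (2 : ℚ) ^ (emin + p - 1) ≤ |b| ∧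
      (2 : ℚ) ^ (emin + 2 * p - 1) ≤ |x * b|)) :
    IsExpansion 1 (scaleExpansion (twoProduct fl s) fl e b) ∧
      (scaleExpansion (twoProduct fl s) fl e b).sum = e.sum * b ∧
      (∀ z ∈ scaleExpansion (twoProduct fl s) fl e b, IsFloat p emin z) ∧
      (scaleExpansion (twoProduct fl s) fl e b).length = 2 * e.length :=
  scaleExpansion_nonoverlapping (by omega) hfl hbrep hMb he heU hexp fun x hx =>
    let h := twoProduct_spec hp hs2 hs2' hfl hodd (roundoffBelow_one (by omega) hfl) (he x hx) hbF
      (hnf x hx)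
    ⟨h.1, h.2.1⟩

/-- **THEOREM 19 with TWO-PRODUCT, round-to-even**: a nonadjacent input gives a nonadjacent output.
[cite: Shewchuk1997, Thm 19 p. 328; Thm 18 p. 326] -/
theorem scaleExpansion_twoProduct_nonadjacent (hp : 4 ≤ p) {s : ℕ} (hs2 : p ≤ 2 * s)
    (hs2' : 2 * s ≤ p + 1) {e : List ℚ} {b : ℚ} {Mb kb : ℤ} (hbrep : b = (Mb : ℚ) * 2 ^ kb)
    (hMb : |Mb| < 2 ^ p) (hbF : IsFloat p emin b) (he : ∀ x ∈ e, IsFloat p emin x)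
    (heU : ∀ x ∈ e, IsFloat p (emin - kb) x) (hexp : IsExpansion 2 e)
    (hnf : ∀ x ∈ e, x * b = 0 ∨ ((2 : ℚ) ^ (emin + p - 1) ≤ |x| ∧ (2 : ℚ) ^ (emin + p - 1) ≤ |b| ∧
      (2 : ℚ) ^ (emin + 2 * p - 1) ≤ |x * b|)) :
    IsExpansion 2 (scaleExpansion (twoProduct (roundTiesEven p emin) s) (roundTiesEven p emin) e b) ∧
      (scaleExpansion (twoProduct (roundTiesEven p emin) s) (roundTiesEven p emin) e b).sum
          = e.sum * b ∧
      (∀ z ∈ scaleExpansion (twoProduct (roundTiesEven p emin) s) (roundTiesEven p emin) e b,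
          IsFloat p emin z) ∧
      (scaleExpansion (twoProduct (roundTiesEven p emin) s) (roundTiesEven p emin) e b).length
          = 2 * e.length :=
  scaleExpansion_nonadjacent (by omega) hbrep hMb he heU hexp fun x hx =>
    let h := twoProduct_spec hp hs2 hs2' (isRoundNearest_roundTiesEven (by omega)) roundTiesEven_neg
      (roundoffBelow_two_roundTiesEven p emin) (he x hx) hbF (hnf x hx)
    ⟨h.1, h.2.1⟩

end Literature.ComputerArithmetic.Shewchuk1997
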